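import Literature.AlgebraicGeometry.Resolution.WeightedCentreUmbrellaQuadMax
import Literature.AlgebraicGeometry.Resolution.WeightedCentreStepUmbrellaReplay
import HarnessLib

/-!
# `max W(v² + w^m u + y z) = (2, 2, 2, m+1, m+1)` and `max W(v² + w^m u + z³) = (2, 3, m+1, m+1)` in EVERY characteristic (pub-rosobs carver-g40, fourth target)

Companion file; statements OURS, in the cell's polynomial weighted-centre model `W(f)` of
`WeightedCentreInvariantSet` / `WeightedCentreUmbrellaPowSecondVertex` (admissible centres `(Ψ, γ)`, `Ψ`
ANY polynomial automorphism fixing the origin, truncated-lex order).  Instrument — NOT a resolution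
theorem.

`WeightedCentreUmbrellaQuadMax` proves `IsMaxInv (W f) [2, 2, 2, m+1, m+1]` for
`f = X_i² + X_j^m X_l + X_{e₁} X_{e₂}` under the hypothesis "`2 ≠ 0` in `k` or `m` even", and
`WeightedCentreUmbrellaCubeMax` proves `IsMaxInv (W f) [2, 3, m+1, m+1]` for `f = X_i² + X_j^m X_l + X_e³`
under "`2 ≠ 0` or `m` even" and "`3 ≠ 0` or `3 ∤ m+1`"; those endgames need `in_{m+1}(V²)`,
`in_{m+1}(Z³)` to be monomials.  This file REMOVES the hypotheses (`isMaxInv_umbrellaQuad'`,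
`isMaxInv_umbrellaCube'`, every field, `m ≥ 2` resp. `m ≥ 3`): in the remaining *purely inseparable*
cases (`2 = 0` and `m` odd; `3 = 0` and `3 ∣ m+1`) the graded identity
`(lin W)^m · lin U = κ · X_d^{m+1} − in_{m+1}(V²) − in_{m+1}(Z³)` of the restricted equation has VANISHING
PARTIAL DERIVATIVES (`m + 1 = 0` in `k`, and the inseparable term is a graded piece of a `p`-th power,
`p = char k`), and differentiating `A^m B` (`m = −1 ≠ 0` in `k`) forces `lin U` to be proportional to
`lin W` or `lin W = 0` — `linForm_prop_of_pderiv_eq_zero`.  A proportional pair of rows is as good as a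
vanishing row for the Jacobian rank obstruction after one linear shear of `Ψ`
(`false_of_jacobian_rows_supported_shear`, built on the tree's `addPolyShear`).  The slice estimates are
those of the two landed files (repeated, since those proofs are monolithic); the good-characteristic
cases are NOT re-proved but invoked.  Smallest new instances: `isMaxInv_umbrellaQuad_three`
(`v² + w³u + yz`, value `(2,2,2,4,4)`, characteristic `2` included) and `isMaxInv_umbrellaCube_five`
(`v² + w⁵u + z³`, value `(2,3,6,6)`, characteristics `2` and `3` included).

References: [AbramovichTemkinWlodarczyk2024] Thm. 5.3.1 (2) (p. 1578), Lemma 5.2.10 (p. 1577);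
[CossartJannsenSaito2020] Def. 7.1, Def. 8.2, §2.2; [CossartPiltant2008] proof of Prop. 4.2 (purely
inseparable equations `v^p + …` in characteristic `p`); [Temkin2025] §1.2.2 (1) (p. 4).
-/

noncomputable section

open MvPolynomial

namespace Literature.AlgebraicGeometry.Resolution.WeightedBlowup

variable {k : Type*} [Field k] {N : ℕ}

/-! ## §1 Tools: derivatives of graded pieces, proportional linear forms, a sheared rank lemma -/

section DerivativeTools

/-- Partial derivatives commute with taking homogeneous components, shifting the degree by one
(plumbing). [folklore] -/
private theorem pderiv_homogeneousComponent (y : Fin N) {n : ℕ} (hn : 1 ≤ n) (P : MvPolynomial (Fin N) k) :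
    pderiv y (homogeneousComponent n P) = homogeneousComponent (n - 1) (pderiv y P) := by
  classical
  ext β
  simp only [coeff_pderiv, coeff_homogeneousComponent]
  have hdeg : (β + Finsupp.single y 1).degree = β.degree + 1 := by
    rw [map_add, Finsupp.degree_single]
  by_cases h : β.degree = n - 1
  · rw [if_pos h, if_pos (by rw [hdeg]; omega)]
  · rw [if_neg h, if_neg (by rw [hdeg]; omega), zero_mul]

/-- In characteristic `2` every homogeneous component of a square of positive degree has vanishing
partial derivatives (plumbing). [folklore] -/
private theorem pderiv_homogeneousComponent_sq_eq_zero (h2 : (2 : k) = 0) (y : Fin N) {n : ℕ} (hn : 1 ≤ n)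
    (P : MvPolynomial (Fin N) k) : pderiv y (homogeneousComponent n (P ^ 2)) = 0 := by
  rw [pderiv_homogeneousComponent y hn, pderiv_pow]
  have : (2 : MvPolynomial (Fin N) k) = 0 := by
    rw [show (2 : MvPolynomial (Fin N) k) = C 2 from (map_ofNat C 2).symm, h2, C_0]
  rw [show ((2 : ℕ) : MvPolynomial (Fin N) k) = 2 from rfl, this, zero_mul, zero_mul, map_zero]

/-- In characteristic `3` every homogeneous component of a cube of positive degree has vanishing
partial derivatives (plumbing). [folklore] -/
private theorem pderiv_homogeneousComponent_cube_eq_zero (h3 : (3 : k) = 0) (y : Fin N) {n : ℕ} (hn : 1 ≤ n)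
    (P : MvPolynomial (Fin N) k) : pderiv y (homogeneousComponent n (P ^ 3)) = 0 := by
  rw [pderiv_homogeneousComponent y hn, pderiv_pow]
  have : (3 : MvPolynomial (Fin N) k) = 0 := by
    rw [show (3 : MvPolynomial (Fin N) k) = C 3 from (map_ofNat C 3).symm, h3, C_0]
  rw [show ((3 : ℕ) : MvPolynomial (Fin N) k) = 3 from rfl, this, zero_mul, zero_mul, map_zero]

/-- `∂_y (c · X_d^n) = 0` when `n = 0` in `k` (plumbing). [folklore] -/
private theorem pderiv_C_mul_X_pow_eq_zero (y d : Fin N) {n : ℕ} (hn : ((n : ℕ) : k) = 0) (c : k) :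
    pderiv y (C c * X d ^ n : MvPolynomial (Fin N) k) = 0 := by
  rw [pderiv_C_mul, pderiv_pow, show ((n : ℕ) : MvPolynomial (Fin N) k) = C (n : k) from
    (map_natCast C n).symm, hn, C_0, zero_mul, zero_mul, mul_zero]

/-- Coefficients of a linear form (plumbing). [folklore] -/
private theorem coeff_single_linForm' (α : Fin N → k) (y : Fin N) :
    coeff (Finsupp.single y 1) (linForm α) = α y := by
  classical
  rw [linForm, coeff_sum, Finset.sum_eq_single y]
  · rw [coeff_C_mul, coeff_X, if_pos rfl, mul_one]
  · intro x _ hxy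
    rw [coeff_C_mul, coeff_X, if_neg (fun h => hxy (Finsupp.single_left_injective one_ne_zero h)), mul_zero]
  · intro h; exact absurd (Finset.mem_univ y) h

/-- A linear form vanishes iff its coefficients do (plumbing). [folklore] -/
private theorem linForm_eq_zero_iff' (α : Fin N → k) : linForm α = 0 ↔ ∀ x, α x = 0 := by
  refine ⟨fun h x => ?_, fun h => ?_⟩
  · rw [← coeff_single_linForm' α x, h, coeff_zero]
  · rw [linForm]
    exact Finset.sum_eq_zero fun x _ => by rw [h x, C_0, zero_mul]

/-- `∂_y` of a linear form is its `y`-coefficient (plumbing). [folklore] -/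
private theorem pderiv_linForm (α : Fin N → k) (y : Fin N) : pderiv y (linForm α) = C (α y) := by
  classical
  rw [linForm, map_sum, Finset.sum_eq_single y]
  · rw [pderiv_C_mul, pderiv_X_self, mul_one]
  · intro x _ hxy
    rw [pderiv_C_mul, pderiv_X_of_ne hxy, mul_zero]
  · intro h; exact absurd (Finset.mem_univ y) h

/-- **Proportionality from `A^m · B = R` with `∂R ≡ 0`.**  If `A, B` are linear forms, `m ≥ 1` with
`m ≠ 0` in `k`, and `A^m · B` has all partial derivatives zero, then `A = 0` or `B` is a scalar multiple
of `A`.  (In the applications `R` is a `p`-th power situation in characteristic `p ∈ {2, 3}`: the graded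
piece of the restricted equation `V² + W^m U + …` where Frobenius kills the derivative.) (derived here;
elementary) [cite: AbramovichTemkinWlodarczyk2024, proof of Thm. 5.3.1 (2)–(3) (p. 1578);
CossartPiltant2008, proof of Prop. 4.2 (purely inseparable case)] -/
theorem linForm_prop_of_pderiv_eq_zero {α β : Fin N → k} {m : ℕ} (hm : 1 ≤ m) (hmk : (m : k) ≠ 0)
    {R : MvPolynomial (Fin N) k} (hR : ∀ y, pderiv y R = 0) (h : linForm α ^ m * linForm β = R) :
    (∀ x, α x = 0) ∨ ∃ μ : k, ∀ x, β x = μ * α x := by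
  classical
  by_cases hα : ∀ x, α x = 0
  · exact Or.inl hα
  right
  obtain ⟨y₀, hy₀⟩ := not_forall.1 hα
  have hA : linForm α ≠ 0 := fun h0 => hy₀ ((linForm_eq_zero_iff' α).1 h0 y₀)
  -- differentiate: `A^{m-1} · (m α_y B + β_y A) = 0`
  have hE : ∀ y, (m : MvPolynomial (Fin N) k) * C (α y) * linForm β + C (β y) * linForm α = 0 := by
    intro y
    have hd := congr_arg (pderiv y) h
    rw [hR y, pderiv_mul, pderiv_pow, pderiv_linForm, pderiv_linForm] at hd
    have hfac : linForm α ^ (m - 1) *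
        ((m : MvPolynomial (Fin N) k) * C (α y) * linForm β + C (β y) * linForm α) = 0 := by
      rw [← hd]
      conv_rhs => rw [show m = m - 1 + 1 from (Nat.sub_add_cancel hm).symm, pow_succ]
      rw [show m - 1 + 1 = m from Nat.sub_add_cancel hm]
      ring
    rcases mul_eq_zero.1 hfac with h0 | h0
    · exact absurd (pow_eq_zero_iff (by intro hm0; rw [hm0, pow_zero] at h0; exact one_ne_zero h0) |>.1 h0) hA
    · exact h0
  refine ⟨-(β y₀) / ((m : k) * α y₀), fun x => ?_⟩
  have hx := congr_arg (coeff (Finsupp.single x 1)) (hE y₀)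
  rw [coeff_add, show (m : MvPolynomial (Fin N) k) = C (m : k) from (map_natCast C m).symm, ← C_mul,
    coeff_C_mul, coeff_C_mul, coeff_single_linForm', coeff_single_linForm', coeff_zero] at hx
  have hmα : (m : k) * α y₀ ≠ 0 := mul_ne_zero hmk hy₀
  field_simp
  linear_combination hx

end DerivativeTools

section ShearedRank

variable {K : Type*} [Field K] {σ : Type*} [DecidableEq σ]

/-- The inverse shear on the sheared variable (plumbing). [folklore] -/
private theorem addPolyShear_symm_X_self (a : σ) (q : MvPolynomial σ K) :
    (addPolyShear a q).symm (X a) = X a - killVar a q := by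
  simp [addPolyShear, sub_eq_add_neg]

/-- The inverse shear fixes the other variables (plumbing). [folklore] -/
private theorem addPolyShear_symm_X_of_ne (a : σ) (q : MvPolynomial σ K) {x : σ} (hx : x ≠ a) :
    (addPolyShear a q).symm (X x) = X x := by
  simp [addPolyShear, hx]

/-- **Rank obstruction with one sheared row.**  If `Ψ` fixes the origin, the rows `x ∈ F` of the Jacobian
of `Ψ⁻¹` at `0` vanish off the columns `S`, and one further row `l ∉ F` is, off `S`, a scalar multiple of
the row `j ≠ l`, then `|F| + 1 ≤ |S|`.  (Reduction to `false_of_jacobian_rows_supported` for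
`Ψ ∘ (X_l ↦ X_l + μ X_j)`.) (derived here)
[cite: AbramovichTemkinWlodarczyk2024, Lemma 5.2.10 (p. 1577) (changes of regular parameters have
invertible Jacobian); CossartJannsenSaito2020, §2.2 (p. 21)] -/
theorem false_of_jacobian_rows_supported_shear {Ψ : MvPolynomial (Fin N) k ≃ₐ[k] MvPolynomial (Fin N) k}
    (hΨ : ∀ m, constantCoeff (Ψ (X m)) = 0) (F S : Finset (Fin N)) (hcard : S.card < F.card + 1)
    {l j : Fin N} (hlj : l ≠ j) (hl : l ∉ F) (μ : k)
    (hoff : ∀ s, s ∉ S → ∀ x ∈ F, coeff (Finsupp.single s 1) (Ψ.symm (X x)) = 0)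
    (hrow : ∀ s, s ∉ S → coeff (Finsupp.single s 1) (Ψ.symm (X l)) =
      μ * coeff (Finsupp.single s 1) (Ψ.symm (X j))) : False := by
  classical
  set θ : MvPolynomial (Fin N) k ≃ₐ[k] MvPolynomial (Fin N) k := addPolyShear l (C μ * X j) with hθ
  have hkill : killVar l (C μ * X j : MvPolynomial (Fin N) k) = C μ * X j := by
    rw [map_mul, algHom_C, killVar_X, if_neg hlj.symm]
    rfl
  have hΨ' : ∀ m, constantCoeff ((Ψ.trans θ) (X m)) = 0 :=
    forall_constantCoeff_trans_X hΨ (fun x => constantCoeff_addPolyShear_X _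
      (by rw [map_mul, constantCoeff_C, constantCoeff_X, mul_zero]) x)
  refine false_of_jacobian_rows_supported hΨ' (insert l F) S
    (by rwa [Finset.card_insert_of_notMem hl]) ?_
  intro s hs x hx
  rw [AlgEquiv.symm_trans_apply]
  rcases Finset.mem_insert.1 hx with rfl | hxF
  · have hC : Ψ.symm (C μ) = C μ := Ψ.symm.commutes μ
    rw [hθ, addPolyShear_symm_X_self, hkill, map_sub, map_mul, hC, coeff_sub, coeff_C_mul, hrow s hs,
      sub_self]
  · have hxl : x ≠ l := fun h => hl (h ▸ hxF)
    rw [hθ, addPolyShear_symm_X_of_ne _ _ hxl]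
    exact hoff s hs x hxF

end ShearedRank

/-! ## §2 The purely inseparable second vertex of the quad-umbrella `X_i² + X_j^m X_l + X_{e₁} X_{e₂}` -/

section SecondVertex

variable {i j l e₁ e₂ : Fin N} {m : ℕ}

/-- Slice `0` of a `SliceOrd` bound (plumbing). [folklore] -/
private theorem SliceOrd.coeff_zero_le₈ {σ : Type*} {w : σ → ℕ} {α s : ℕ} {P : Polynomial (MvPolynomial σ k)}
    (h : SliceOrd w α s P) : (s : ℕ∞) ≤ monomialOrd w (P.coeff 0) := by
  simpa using h 0

/-- Slice `1` of a `SliceOrd` bound (plumbing). [folklore] -/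
private theorem SliceOrd.coeff_one_le₈ {σ : Type*} {w : σ → ℕ} {α s : ℕ} {P : Polynomial (MvPolynomial σ k)}
    (h : SliceOrd w α s P) : ((s - α : ℕ) : ℕ∞) ≤ monomialOrd w (P.coeff 1) := by
  simpa using h 1

/-- Coefficients of the normal form `C p₀ + C p₁ ε + C p₂ ε² + C p₃ ε³` (plumbing). [folklore] -/
private theorem coeff_normalForm₈ {R : Type*} [CommSemiring R] (p₀ p₁ p₂ p₃ : R) :
    (Polynomial.C p₀ + Polynomial.C p₁ * Polynomial.X + Polynomial.C p₂ * Polynomial.X ^ 2 +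
        Polynomial.C p₃ * Polynomial.X ^ 3).coeff 0 = p₀ ∧
    (Polynomial.C p₀ + Polynomial.C p₁ * Polynomial.X + Polynomial.C p₂ * Polynomial.X ^ 2 +
        Polynomial.C p₃ * Polynomial.X ^ 3).coeff 1 = p₁ := by
  simp only [Polynomial.coeff_add, Polynomial.coeff_C, Polynomial.coeff_C_mul_X, Polynomial.coeff_C_mul_X_pow]
  simp

/-- The weight as a sum over all variables (plumbing). [folklore] -/
private theorem weight_eq_sum_univ₈ (w : Fin N → ℕ) (dd : Fin N →₀ ℕ) : Finsupp.weight w dd = ∑ x, dd x * w x := by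
  rw [Finsupp.weight_apply, Finsupp.sum_fintype dd _ (fun _ => by simp)]
  simp only [smul_eq_mul]

/-- The monomial valuation as a sum over all variables (plumbing). [folklore] -/
private theorem monomialValuation_eq_sum_univ₈ (γ : Fin N → ℚ) (dd : Fin N →₀ ℕ) :
    monomialValuation γ dd = ∑ x, (dd x : ℚ) * γ x := by
  rw [monomialValuation, Finsupp.sum_fintype]
  intro i; simp

/-- Linear coefficients of a polynomial with vanishing linear part (plumbing). [folklore] -/
private theorem coeff_single_one_eq_zero_of_lin' {P : MvPolynomial (Fin N) k} (h : homogeneousComponent 1 P = 0)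
    (s : Fin N) : coeff (Finsupp.single s 1) P = 0 := by
  classical
  have := congrArg (coeff (Finsupp.single s 1)) h
  rwa [coeff_homogeneousComponent, if_pos (by rw [Finsupp.degree_single]), coeff_zero] at this

/-- **Second vertex, weight form — the purely inseparable case** `2 = 0` in `k`, `m` odd.  For
`f = X_i² + X_j^m X_l + X_{e₁} X_{e₂}` (`i, j, l, e₁, e₂` distinct, spectators allowed, `m ≥ 2`) there is NO centre `(Ψ, γ)` — `Ψ` ANY polynomial
automorphism fixing the origin — with weights `γ a₁ = γ a₂ = γ a₃ = 1/2`, `γ d ≤ 1/(m+1)` for a variable `d`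
outside `{a₁, a₂, a₃}`, and all other weights `≤ q/p` where `(m+1)q < p`.  Endgame: the graded identity
`(lin W)^m · lin U = κ X_d^{m+1} − in_{m+1}(V²)` has vanishing partial derivatives (Frobenius), whence
`lin U ∥ lin W` (`linForm_prop_of_pderiv_eq_zero`) and the sheared rank obstruction applies. (derived here)
[cite: AbramovichTemkinWlodarczyk2024, Thm. 5.3.1 (2) (p. 1578), Lemma 5.2.6–5.2.10 (p. 1577), §3.4 (p. 1570);
CossartJannsenSaito2020, Def. 7.1 (p. 107), §2.2 (p. 21); CossartPiltant2008, proof of Prop. 4.2;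
Temkin2025, §1.2.2 (1) (p. 4)] -/
theorem not_isCentreFor_umbrellaQuad_vertex_of_two_eq_zero (hij : i ≠ j) (hil : i ≠ l) (hi₁ : i ≠ e₁) (hi₂ : i ≠ e₂)
    (hjl : j ≠ l) (hj₁ : j ≠ e₁) (hj₂ : j ≠ e₂) (hl₁ : l ≠ e₁) (hl₂ : l ≠ e₂) (h₁₂ : e₁ ≠ e₂) (hm : 2 ≤ m)
    (h2 : (2 : k) = 0) (hodd : Odd m)
    {Ψ : MvPolynomial (Fin N) k ≃ₐ[k] MvPolynomial (Fin N) k} {γ : Fin N → ℚ} {a₁ a₂ a₃ d : Fin N}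
    (hγa₁ : γ a₁ = 1 / 2) (hγa₂ : γ a₂ = 1 / 2) (hγa₃ : γ a₃ = 1 / 2) (hd₁ : d ≠ a₁) (hd₂ : d ≠ a₂)
    (hd₃ : d ≠ a₃) (hγd : γ d ≤ 1 / ((m + 1 : ℕ) : ℚ)) {p q : ℕ} (hpq : (m + 1) * q < p)
    (hE : ∀ x, x ≠ a₁ → x ≠ a₂ → x ≠ a₃ → x ≠ d → γ x ≤ (q : ℚ) / p) :
    ¬ IsCentreFor (umbrellaQuad k i j l e₁ e₂ m) Ψ γ := by
  classical
  intro hc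
  set f := umbrellaQuad k i j l e₁ e₂ m with hf
  obtain ⟨K, hK⟩ : ∃ K, (m + 1) * p = K := ⟨_, rfl⟩
  have hp0 : 0 < p := by omega
  have hK6 : 6 * (m + 1) * p = 6 * K := by rw [← hK]; ring
  have hM0 : (0 : ℚ) < ((m + 1 : ℕ) : ℚ) := by positivity
  -- the restriction `ρ = κ ∘ Ψ⁻¹`, `κ` killing `X_{a₁}, X_{a₂}, X_{a₃}`
  set H : Finset (Fin N) := {a₁, a₂, a₃} with hH
  have hdH : d ∉ H := by simp [hH, hd₁, hd₂, hd₃]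
  have hnotH : ∀ x, x ∉ H → x ≠ a₁ ∧ x ≠ a₂ ∧ x ≠ a₃ := fun x hx => by
    simpa only [hH, Finset.mem_insert, Finset.mem_singleton, not_or] using hx
  obtain ⟨ρ, hρ⟩ : ∃ ρ : MvPolynomial (Fin N) k →ₐ[k] MvPolynomial (Fin N) k,
      ∀ P, ρ P = killHom H (Ψ.symm P) :=
    ⟨(killHom H).comp (Ψ.symm : MvPolynomial (Fin N) k →ₐ[k] MvPolynomial (Fin N) k), fun _ => rfl⟩
  have hρΨ : ∀ x, ρ (Ψ (X x)) = killHom H (X x) := fun x => by rw [hρ, AlgEquiv.symm_apply_apply]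
  have hρA : ∀ x, x ∈ H → ρ (Ψ (X x)) = 0 := fun x hx => by rw [hρΨ, killHom_X_of_mem hx]
  have hρx : ∀ x, x ∉ H → ρ (Ψ (X x)) = X x := fun x hx => by rw [hρΨ, killHom_X_of_not_mem hx]
  have hΨs0 : ∀ x, constantCoeff (Ψ.symm (X x)) = 0 := constantCoeff_symm_X_eq_zero_of_forall Ψ hc.1
  have hρX0 : ∀ x, constantCoeff (ρ (X x)) = 0 := fun x => by rw [hρ, constantCoeff_killHom, hΨs0]
  have hρ1 : ∀ P y, y ∉ H → coeff (Finsupp.single y 1) (ρ P) = coeff (Finsupp.single y 1) (Ψ.symm P) := by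
    intro P y hy
    rw [hρ, coeff_killHom_of_forall_eq_zero]
    intro x hx
    exact Finsupp.single_eq_of_ne (ne_of_mem_of_not_mem hx hy)
  set V := ρ (X i) with hV
  set W := ρ (X j) with hW
  set U := ρ (X l) with hU
  set E₁ := ρ (X e₁) with hE₁
  set E₂ := ρ (X e₂) with hE₂
  have hV0 : constantCoeff V = 0 := hρX0 i
  have hW0 : constantCoeff W = 0 := hρX0 j
  have hU0 : constantCoeff U = 0 := hρX0 l
  have hE₁0 : constantCoeff E₁ = 0 := hρX0 e₁
  have hE₂0 : constantCoeff E₂ = 0 := hρX0 e₂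
  -- integer weights: `6p` on `X_d`, `6(m+1)q` elsewhere; source weights `qs`
  obtain ⟨Wt, hWt⟩ : ∃ Wt : Fin N → ℕ, Wt = heavyWeights d (m + 1) p q := ⟨_, rfl⟩
  have hWtle : ∀ x, Wt x ≤ 2 * K := by
    intro x
    rw [hWt, heavyWeights]
    split_ifs
    · nlinarith
    · nlinarith
  obtain ⟨qs, hqs⟩ : ∃ qs : Fin N → ℕ, ∀ x, qs x = if x ∈ H then 3 * K else Wt x := ⟨_, fun _ => rfl⟩
  have hqsA : ∀ x, x ∈ H → qs x = 3 * K := fun x hx => by rw [hqs, if_pos hx]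
  have hqsx : ∀ x, x ∉ H → qs x = Wt x := fun x hx => by rw [hqs, if_neg hx]
  -- admissibility of `Ψ⁻¹ f` in the source weights
  have hqsγ : ∀ x, (6 * K : ℚ) * γ x ≤ (qs x : ℚ) := by
    intro x
    by_cases hxH : x ∈ H
    · have hγx : γ x = 1 / 2 := by
        simp only [hH, Finset.mem_insert, Finset.mem_singleton] at hxH
        rcases hxH with rfl | rfl | rfl
        exacts [hγa₁, hγa₂, hγa₃]
      rw [hqsA x hxH, hγx]; push_cast; linarith
    obtain ⟨hx₁, hx₂, hx₃⟩ := hnotH x hxH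
    rw [hqsx x hxH, hWt, heavyWeights]
    have hKq : (K : ℚ) = ((m + 1 : ℕ) : ℚ) * p := by rw [← hK]; push_cast; ring
    by_cases hxd : x = d
    · rw [if_pos hxd, hxd]
      calc (6 * K : ℚ) * γ d ≤ 6 * K * (1 / ((m + 1 : ℕ) : ℚ)) := mul_le_mul_of_nonneg_left hγd (by positivity)
        _ = ((6 * p : ℕ) : ℚ) := by rw [hKq]; field_simp; push_cast; ring
    · rw [if_neg hxd]
      calc (6 * K : ℚ) * γ x ≤ 6 * K * ((q : ℚ) / p) :=
            mul_le_mul_of_nonneg_left (hE x hx₁ hx₂ hx₃ hxd) (by positivity)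
        _ = ((6 * (m + 1) * q : ℕ) : ℚ) := by
          rw [hKq]; field_simp; push_cast; ring
  have hadm : ∀ dd ∈ (Ψ.symm f).support, 6 * K ≤ Finsupp.weight qs dd := by
    intro dd hdd
    have h1 : (1 : ℚ) ≤ ∑ x, (dd x : ℚ) * γ x := by
      rw [← monomialValuation_eq_sum_univ₈]; exact hc.2.2 dd hdd
    have h2 : ((Finsupp.weight qs dd : ℕ) : ℚ) = ∑ x, (dd x : ℚ) * (qs x : ℚ) := by
      rw [weight_eq_sum_univ₈]; push_cast; rfl
    have h3 : ((6 * K : ℕ) : ℚ) ≤ ∑ x, (dd x : ℚ) * (qs x : ℚ) := by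
      calc ((6 * K : ℕ) : ℚ) = (6 * K : ℚ) * 1 := by push_cast; ring
        _ ≤ (6 * K : ℚ) * ∑ x, (dd x : ℚ) * γ x := mul_le_mul_of_nonneg_left h1 (by positivity)
        _ = ∑ x, (dd x : ℚ) * ((6 * K : ℚ) * γ x) := by
          rw [Finset.mul_sum]; exact Finset.sum_congr rfl fun x _ => by ring
        _ ≤ ∑ x, (dd x : ℚ) * (qs x : ℚ) :=
          Finset.sum_le_sum fun x _ => mul_le_mul_of_nonneg_left (hqsγ x) (by positivity)
    rw [← h2] at h3
    exact_mod_cast h3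
  -- SliceOrd bounds for the generators (all from the `ε⁰`-slice), and the transfer to `f`
  have hgen : ∀ (ξ : Fin N → MvPolynomial (Fin N) k) (x : Fin N),
      SliceOrd Wt (3 * K) (qs x) (fieldTaylorₐ ρ ξ (Ψ (X x))) := by
    intro ξ x
    by_cases hxH : x ∈ H
    · rw [hqsA x hxH]
      refine sliceOrd_of_coeff ?_ ?_ (by omega)
      · rw [coeff_zero_fieldTaylorₐ, hρA x hxH, monomialOrd_zero]; exact le_top
      · rw [Nat.sub_self, Nat.cast_zero]; exact zero_le
    · have hq2 : qs x ≤ 2 * K := by rw [hqsx x hxH]; exact hWtle x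
      refine sliceOrd_of_coeff ?_ ?_ (by omega)
      · rw [coeff_zero_fieldTaylorₐ, hρx x hxH, monomialOrd_X, hqsx x hxH]
      · rw [Nat.sub_eq_zero_of_le (by omega), Nat.cast_zero]; exact zero_le
  have hTf : ∀ ξ : Fin N → MvPolynomial (Fin N) k, SliceOrd Wt (3 * K) (6 * K) (fieldTaylorₐ ρ ξ f) := by
    intro ξ
    have h := SliceOrd.map (φ := (fieldTaylorₐ ρ ξ).comp (Ψ : MvPolynomial (Fin N) k →ₐ[k] MvPolynomial (Fin N) k))
      qs (fun x => hgen ξ x) (F := Ψ.symm f) hadm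
    have h' : SliceOrd Wt (3 * K) (6 * K) (fieldTaylorₐ ρ ξ (Ψ (Ψ.symm f))) := h
    rwa [AlgEquiv.apply_symm_apply] at h'
  -- (T_{e₁}) the direction `∂_{e₁}`: `ord E₂ ≥ 3K`
  set ξ₁ : Fin N → MvPolynomial (Fin N) k := fun x => if x = e₁ then 1 else 0 with hξ₁
  have hexp1 : fieldTaylorₐ ρ ξ₁ f = Polynomial.C (V ^ 2 + W ^ m * U + E₁ * E₂) +
      Polynomial.C E₂ * Polynomial.X + Polynomial.C 0 * Polynomial.X ^ 2 + Polynomial.C 0 * Polynomial.X ^ 3 := by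
    have e1 : ξ₁ i = 0 := by simp [hξ₁, hi₁]
    have e2 : ξ₁ j = 0 := by simp [hξ₁, hj₁]
    have e3 : ξ₁ l = 0 := by simp [hξ₁, hl₁]
    have e4 : ξ₁ e₁ = 1 := by simp [hξ₁]
    have e5 : ξ₁ e₂ = 0 := by simp [hξ₁, h₁₂.symm]
    rw [hf, umbrellaQuad_eq]
    simp only [map_add, map_mul, map_pow, fieldTaylorₐ_X, e1, e2, e3, e4, e5, map_one, map_zero, mul_zero,
      add_zero]
    ring
  have hE₂3 : ((3 * K : ℕ) : ℕ∞) ≤ monomialOrd Wt E₂ := by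
    have h := (hTf ξ₁).coeff_one_le₈
    rwa [hexp1, (coeff_normalForm₈ _ _ _ _).2, show 6 * K - 3 * K = 3 * K by omega] at h
  have hG : ((6 * K : ℕ) : ℕ∞) ≤ monomialOrd Wt (V ^ 2 + W ^ m * U + E₁ * E₂) := by
    have h := (hTf ξ₁).coeff_zero_le₈; rwa [hexp1, (coeff_normalForm₈ _ _ _ _).1] at h
  -- (T_{e₂}) the direction `∂_{e₂}`: `ord E₁ ≥ 3K`
  set ξ₂ : Fin N → MvPolynomial (Fin N) k := fun x => if x = e₂ then 1 else 0 with hξ₂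
  have hexp2 : fieldTaylorₐ ρ ξ₂ f = Polynomial.C (V ^ 2 + W ^ m * U + E₁ * E₂) +
      Polynomial.C E₁ * Polynomial.X + Polynomial.C 0 * Polynomial.X ^ 2 + Polynomial.C 0 * Polynomial.X ^ 3 := by
    have e1 : ξ₂ i = 0 := by simp [hξ₂, hi₂]
    have e2 : ξ₂ j = 0 := by simp [hξ₂, hj₂]
    have e3 : ξ₂ l = 0 := by simp [hξ₂, hl₂]
    have e4 : ξ₂ e₁ = 0 := by simp [hξ₂, h₁₂]
    have e5 : ξ₂ e₂ = 1 := by simp [hξ₂]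
    rw [hf, umbrellaQuad_eq]
    simp only [map_add, map_mul, map_pow, fieldTaylorₐ_X, e1, e2, e3, e4, e5, map_one, map_zero, mul_zero,
      add_zero]
    ring
  have hE₁3 : ((3 * K : ℕ) : ℕ∞) ≤ monomialOrd Wt E₁ := by
    have h := (hTf ξ₂).coeff_one_le₈
    rwa [hexp2, (coeff_normalForm₈ _ _ _ _).2, show 6 * K - 3 * K = 3 * K by omega] at h
  -- low-degree components (`M = m + 1`): `in_n` of `G`, `V²`, `E₁ E₂`, `E₁²`, `E₂²`
  have hpq' : (m + 1) * q < p := hpq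
  have h6K : ∀ P Q : MvPolynomial (Fin N) k, ((3 * K : ℕ) : ℕ∞) ≤ monomialOrd Wt P →
      ((3 * K : ℕ) : ℕ∞) ≤ monomialOrd Wt Q →
      ((6 * (m + 1) * p : ℕ) : ℕ∞) ≤ monomialOrd (heavyWeights d (m + 1) p q) (P * Q) := by
    intro P Q hP hQ
    rw [hK6, ← hWt, show 6 * K = 3 * K + 3 * K by omega, Nat.cast_add]
    exact (add_le_add hP hQ).trans (add_monomialOrd_le_mul Wt P Q)
  obtain ⟨hEElow, hEEM⟩ := homogeneousComponent_of_le_monomialOrd_heavyWeights hpq' (h6K E₁ E₂ hE₁3 hE₂3)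
  have hE₁sq := (homogeneousComponent_of_le_monomialOrd_heavyWeights hpq' (h6K E₁ E₁ hE₁3 hE₁3)).1 2 (by omega)
  have hE₂sq := (homogeneousComponent_of_le_monomialOrd_heavyWeights hpq' (h6K E₂ E₂ hE₂3 hE₂3)).1 2 (by omega)
  have hG' : ((6 * (m + 1) * p : ℕ) : ℕ∞) ≤
      monomialOrd (heavyWeights d (m + 1) p q) (V ^ 2 + W ^ m * U + E₁ * E₂) := by
    rw [hK6, ← hWt]; exact hG
  obtain ⟨hGlow, hGM⟩ := homogeneousComponent_of_le_monomialOrd_heavyWeights hpq' hG'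
  -- degree-order bounds
  have hV1 : ((1 : ℕ) : ℕ∞) ≤ monomialOrd (fun _ => 1) V := by
    rw [Nat.cast_one]; exact one_le_monomialOrd_one_of_constantCoeff_eq_zero _ hV0
  have hW1 : ((1 : ℕ) : ℕ∞) ≤ monomialOrd (fun _ => 1) W := by
    rw [Nat.cast_one]; exact one_le_monomialOrd_one_of_constantCoeff_eq_zero _ hW0
  have hU1 : ((1 : ℕ) : ℕ∞) ≤ monomialOrd (fun _ => 1) U := by
    rw [Nat.cast_one]; exact one_le_monomialOrd_one_of_constantCoeff_eq_zero _ hU0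
  have hE₁1 : ((1 : ℕ) : ℕ∞) ≤ monomialOrd (fun _ => 1) E₁ := by
    rw [Nat.cast_one]; exact one_le_monomialOrd_one_of_constantCoeff_eq_zero _ hE₁0
  have hE₂1 : ((1 : ℕ) : ℕ∞) ≤ monomialOrd (fun _ => 1) E₂ := by
    rw [Nat.cast_one]; exact one_le_monomialOrd_one_of_constantCoeff_eq_zero _ hE₂0
  have hWm : ((m : ℕ) : ℕ∞) ≤ monomialOrd (fun _ => 1) (W ^ m) := by
    have h := nsmul_monomialOrd_le_pow (fun _ => 1) W m
    refine le_trans ?_ h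
    calc ((m : ℕ) : ℕ∞) = m • ((1 : ℕ) : ℕ∞) := by rw [Nat.cast_one, nsmul_one]
      _ ≤ m • monomialOrd (fun _ => 1) W := nsmul_le_nsmul_right hW1 m
  have hWU : ((m + 1 : ℕ) : ℕ∞) ≤ monomialOrd (fun _ => 1) (W ^ m * U) := by
    rw [Nat.cast_add]
    exact (add_le_add hWm hU1).trans (add_monomialOrd_le_mul _ _ _)
  -- `lin E₁ = lin E₂ = 0` from `in₂(E_r²) = (lin E_r)² = 0`
  have hlinE₁ : homogeneousComponent 1 E₁ = 0 := by
    have hsq := homogeneousComponent_mul_pow_of_le_monomialOrd E₁ hE₁1 2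
    rw [← pow_two] at hE₁sq
    rw [Nat.mul_one, hE₁sq] at hsq
    exact pow_eq_zero_iff two_ne_zero |>.1 hsq.symm
  have hlinE₂ : homogeneousComponent 1 E₂ = 0 := by
    have hsq := homogeneousComponent_mul_pow_of_le_monomialOrd E₂ hE₂1 2
    rw [← pow_two] at hE₂sq
    rw [Nat.mul_one, hE₂sq] at hsq
    exact pow_eq_zero_iff two_ne_zero |>.1 hsq.symm
  -- `lin V = 0` from `in₂ G = 0`
  have hlinV : homogeneousComponent 1 V = 0 := by
    have h2G := hGlow 2 (by omega)
    have hsq := homogeneousComponent_mul_pow_of_le_monomialOrd V hV1 2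
    rw [Nat.mul_one] at hsq
    rw [map_add, map_add, hsq, homogeneousComponent_eq_zero_of_lt_monomialOrd _ (by omega : 2 < m + 1) hWU,
      hEElow 2 (by omega), add_zero, add_zero] at h2G
    exact pow_eq_zero_iff two_ne_zero |>.1 h2G
  -- `(lin W)^m · lin U = κ X_d^{m+1}`
  have hprod : homogeneousComponent (m + 1) (W ^ m * U) =
      homogeneousComponent 1 W ^ m * homogeneousComponent 1 U := by
    have hpw := homogeneousComponent_mul_pow_of_le_monomialOrd W hW1 m
    rw [Nat.mul_one] at hpw
    rw [homogeneousComponent_add_mul_of_le_monomialOrd (W ^ m) U hWm hU1, hpw]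
  set κG := coeff (Finsupp.single d (m + 1)) (V ^ 2 + W ^ m * U + E₁ * E₂) with hκG
  set κE := coeff (Finsupp.single d (m + 1)) (E₁ * E₂) with hκE
  have hstar : linForm (fun y => coeff (Finsupp.single y 1) W) ^ m *
      linForm (fun y => coeff (Finsupp.single y 1) U) =
      C (κG - κE) * X d ^ (m + 1) - homogeneousComponent (m + 1) (V ^ 2) := by
    rw [← homogeneousComponent_one_eq_linForm, ← homogeneousComponent_one_eq_linForm, ← hprod]
    rw [map_add, map_add, hEEM] at hGM
    have : homogeneousComponent (m + 1) (W ^ m * U) =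
        C κG * X d ^ (m + 1) - C κE * X d ^ (m + 1) - homogeneousComponent (m + 1) (V ^ 2) := by
      rw [← hGM]; ring
    rw [this, map_sub]; ring
  -- the right-hand side has vanishing partial derivatives (`2 = 0`, `m + 1` even)
  have hM2 : (((m + 1 : ℕ) : ℕ) : k) = 0 := by
    obtain ⟨r, hr⟩ := hodd
    rw [hr, show 2 * r + 1 + 1 = 2 * (r + 1) by ring, Nat.cast_mul, Nat.cast_ofNat, h2, zero_mul]
  have hmk : (m : k) ≠ 0 := by
    obtain ⟨r, hr⟩ := hodd
    rw [hr, Nat.cast_add, Nat.cast_mul, Nat.cast_ofNat, h2, zero_mul, zero_add, Nat.cast_one]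
    exact one_ne_zero
  have hR : ∀ y, pderiv y (C (κG - κE) * X d ^ (m + 1) - homogeneousComponent (m + 1) (V ^ 2)) = 0 := by
    intro y
    rw [map_sub, pderiv_C_mul_X_pow_eq_zero y d hM2, pderiv_homogeneousComponent_sq_eq_zero h2 y (by omega),
      sub_zero]
  -- rows of the Jacobian of `Ψ⁻¹` at `0`
  have hrow : ∀ x s, s ∉ H → coeff (Finsupp.single s 1) (ρ (X x)) = 0 →
      coeff (Finsupp.single s 1) (Ψ.symm (X x)) = 0 := by
    intro x s hs h
    rwa [hρ1 (X x) s hs] at h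
  have hrowV := coeff_single_one_eq_zero_of_lin' hlinV
  have hrowE₁ := coeff_single_one_eq_zero_of_lin' hlinE₁
  have hrowE₂ := coeff_single_one_eq_zero_of_lin' hlinE₂
  have hsH : ∀ s, s ≠ a₁ → s ≠ a₂ → s ≠ a₃ → s ∉ H := fun s h1 h2 h3 => by
    simp [hH, h1, h2, h3]
  have hcard3 : ({i, e₁, e₂} : Finset (Fin N)).card = 3 := by
    rw [Finset.card_insert_of_notMem (by simp [hi₁, hi₂]), Finset.card_pair h₁₂]
  rcases linForm_prop_of_pderiv_eq_zero (by omega : 1 ≤ m) hmk hR hstar with hWz | ⟨μ, hμ⟩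
  · -- `lin W = 0`: rows `i, e₁, e₂, j` supported on the columns `a₁, a₂, a₃`
    refine false_of_jacobian_rows_supported hc.1 {i, e₁, e₂, j} {a₁, a₂, a₃}
      (lt_of_le_of_lt Finset.card_le_three (by
        rw [Finset.card_insert_of_notMem (by simp [hi₁, hi₂, hij]),
          Finset.card_insert_of_notMem (by simp [h₁₂, hj₁.symm]), Finset.card_pair hj₂.symm]
        norm_num)) ?_
    intro s hs x hx
    simp only [Finset.mem_insert, Finset.mem_singleton, not_or] at hs hx
    obtain ⟨hs1, hs2, hs3⟩ := hs
    refine hrow x s (hsH s hs1 hs2 hs3) ?_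
    rcases hx with rfl | rfl | rfl | rfl
    · exact hrowV s
    · exact hrowE₁ s
    · exact hrowE₂ s
    · exact hWz s
  · -- `lin U = μ · lin W`: rows `i, e₁, e₂` vanish and row `l − μ · row j` vanishes off `a₁, a₂, a₃`
    refine false_of_jacobian_rows_supported_shear hc.1 {i, e₁, e₂} {a₁, a₂, a₃}
      (lt_of_le_of_lt Finset.card_le_three (by rw [hcard3]; norm_num)) hjl.symm
      (by simp [hil.symm, hl₁, hl₂]) μ ?_ ?_
    · intro s hs x hx
      simp only [Finset.mem_insert, Finset.mem_singleton, not_or] at hs hx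
      obtain ⟨hs1, hs2, hs3⟩ := hs
      refine hrow x s (hsH s hs1 hs2 hs3) ?_
      rcases hx with rfl | rfl | rfl
      · exact hrowV s
      · exact hrowE₁ s
      · exact hrowE₂ s
    · intro s hs
      simp only [Finset.mem_insert, Finset.mem_singleton, not_or] at hs
      obtain ⟨hs1, hs2, hs3⟩ := hs
      rw [← hρ1 (X l) s (hsH s hs1 hs2 hs3), ← hρ1 (X j) s (hsH s hs1 hs2 hs3)]
      exact hμ s

/-- **Second vertex, weight form, EVERY characteristic** (`m ≥ 2`; no parity hypothesis): the landed
`not_isCentreFor_umbrellaQuad_vertex` (`2 ≠ 0` or `m` even) glued with the purely inseparable case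
above. (derived here)
[cite: AbramovichTemkinWlodarczyk2024, Thm. 5.3.1 (2) (p. 1578); CossartPiltant2008, proof of Prop. 4.2;
Temkin2025, §1.2.2 (1) (p. 4)] -/
theorem not_isCentreFor_umbrellaQuad_vertex' (hij : i ≠ j) (hil : i ≠ l) (hi₁ : i ≠ e₁) (hi₂ : i ≠ e₂)
    (hjl : j ≠ l) (hj₁ : j ≠ e₁) (hj₂ : j ≠ e₂) (hl₁ : l ≠ e₁) (hl₂ : l ≠ e₂) (h₁₂ : e₁ ≠ e₂) (hm : 2 ≤ m)
    {Ψ : MvPolynomial (Fin N) k ≃ₐ[k] MvPolynomial (Fin N) k} {γ : Fin N → ℚ} {a₁ a₂ a₃ d : Fin N}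
    (hγa₁ : γ a₁ = 1 / 2) (hγa₂ : γ a₂ = 1 / 2) (hγa₃ : γ a₃ = 1 / 2) (hd₁ : d ≠ a₁) (hd₂ : d ≠ a₂)
    (hd₃ : d ≠ a₃) (hγd : γ d ≤ 1 / ((m + 1 : ℕ) : ℚ)) {p q : ℕ} (hpq : (m + 1) * q < p)
    (hE : ∀ x, x ≠ a₁ → x ≠ a₂ → x ≠ a₃ → x ≠ d → γ x ≤ (q : ℚ) / p) :
    ¬ IsCentreFor (umbrellaQuad k i j l e₁ e₂ m) Ψ γ := by
  by_cases h : (2 : k) ≠ 0 ∨ Even m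
  · exact not_isCentreFor_umbrellaQuad_vertex hij hil hi₁ hi₂ hjl hj₁ hj₂ hl₁ hl₂ h₁₂ hm h hγa₁ hγa₂ hγa₃
      hd₁ hd₂ hd₃ hγd hpq hE
  · rw [not_or, not_not, Nat.not_even_iff_odd] at h
    exact not_isCentreFor_umbrellaQuad_vertex_of_two_eq_zero hij hil hi₁ hi₂ hjl hj₁ hj₂ hl₁ hl₂ h₁₂ hm h.1 h.2
      hγa₁ hγa₂ hγa₃ hd₁ hd₂ hd₃ hγd hpq hE

end SecondVertex

/-! ## §3 `max W = (2, 2, 2, m+1, m+1)` in every characteristic -/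

section Assembly

variable {i j l e₁ e₂ : Fin N} {m : ℕ}

/-- Every non-zero weight contributes its inverse to `exps` (plumbing). [folklore] -/
private theorem inv_mem_exps_of_ne_zero₈ {γ : Fin N → ℚ} {x : Fin N} (hx : γ x ≠ 0) : (γ x)⁻¹ ∈ exps γ := by
  classical
  unfold exps
  rw [List.mem_insertionSort, List.mem_map]
  exact ⟨x, Finset.mem_toList.2 (Finset.mem_filter.2 ⟨Finset.mem_univ _, hx⟩), rfl⟩

/-- Heads of sorted lists (plumbing). [folklore] -/
private theorem le_of_mem_of_pairwise₈ {a x : ℚ} {es : List ℚ} (hs : (a :: es).Pairwise (· ≤ ·))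
    (hx : x ∈ a :: es) : a ≤ x := by
  rcases List.mem_cons.1 hx with rfl | hx
  · exact le_rfl
  · exact (List.pairwise_cons.1 hs).1 x hx

/-- Non-negativity survives forgetting a variable (plumbing). [folklore] -/
private theorem update_nonneg₈ {γ : Fin N → ℚ} (hγ : ∀ x, 0 ≤ γ x) (a : Fin N) (x : Fin N) :
    0 ≤ Function.update γ a 0 x := by
  by_cases hx : x = a
  · subst hx; simp
  · rw [Function.update_of_ne hx]; exact hγ x

/-- Four distinct indices leave one outside any triple (plumbing). [folklore] -/
private theorem exists_ne_ne_ne₄ {i j l e : Fin N} (hij : i ≠ j) (hil : i ≠ l) (hie : i ≠ e) (hjl : j ≠ l)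
    (hje : j ≠ e) (hle : l ≠ e) (a b c : Fin N) : ∃ d, d ≠ a ∧ d ≠ b ∧ d ≠ c := by
  classical
  have h4 : ({i, j, l, e} : Finset (Fin N)).card = 4 := by
    rw [Finset.card_insert_of_notMem (by simp [hij, hil, hie]), Finset.card_insert_of_notMem (by simp [hjl, hje]),
      Finset.card_pair hle]
  have hcard : ({a, b, c} : Finset (Fin N)).card < ({i, j, l, e} : Finset (Fin N)).card :=
    lt_of_le_of_lt Finset.card_le_three (by rw [h4]; norm_num)
  obtain ⟨d, -, hd⟩ := Finset.exists_mem_notMem_of_card_lt_card hcard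
  simp only [Finset.mem_insert, Finset.mem_singleton, not_or] at hd
  exact ⟨d, hd.1, hd.2.1, hd.2.2⟩

/-- A rational `c > M` as a ratio `p/q` of naturals with `Mq < p` (plumbing). [folklore] -/
private theorem exists_ratio_of_lt₈ {M : ℕ} {c : ℚ} (hMc : (M : ℚ) < c) :
    ∃ p q : ℕ, M * q < p ∧ 1 / c = (q : ℚ) / p := by
  have hc0 : 0 < c := lt_of_le_of_lt (Nat.cast_nonneg M) hMc
  have hnum : 0 < c.num := Rat.num_pos.2 hc0
  have hp : ((c.num.toNat : ℕ) : ℚ) = (c.num : ℚ) := by exact_mod_cast Int.toNat_of_nonneg hnum.le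
  have key : c * c.den = c.num := Rat.mul_den_eq_num c
  refine ⟨c.num.toNat, c.den, ?_, ?_⟩
  · have h : (M : ℚ) * c.den < c * c.den := mul_lt_mul_of_pos_right hMc (by exact_mod_cast c.den_pos)
    rw [key, ← hp] at h
    exact_mod_cast h
  · rw [hp, div_eq_div_iff hc0.ne' (by exact_mod_cast hnum.ne'), one_mul, mul_comm]
    exact key.symm

/-- **Second vertex, invariant form**: no centre for `X_i² + X_j^m X_l + X_{e₁} X_{e₂}` has invariant
`(2, 2, 2, t…)` with `(m+1, m+1) <_trunc t` — i.e. `t = ()`, or `t = (c₄, …)` with `c₄ > m+1`, or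
`t = (m+1)`, or `t = (m+1, c₅, …)` with `c₅ > m+1` (`m ≥ 2`; EVERY characteristic; ALL polynomial
coordinate changes). (derived here)
[cite: AbramovichTemkinWlodarczyk2024, Thm. 5.3.1 (2) (p. 1578); CossartPiltant2008, proof of Prop. 4.2;
Temkin2025, §1.2.2 (1) (p. 4)] -/
theorem not_isCentreFor_umbrellaQuad_of_exps' (hij : i ≠ j) (hil : i ≠ l) (hi₁ : i ≠ e₁) (hi₂ : i ≠ e₂)
    (hjl : j ≠ l) (hj₁ : j ≠ e₁) (hj₂ : j ≠ e₂) (hl₁ : l ≠ e₁) (hl₂ : l ≠ e₂) (h₁₂ : e₁ ≠ e₂) (hm : 2 ≤ m)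
    {Ψ : MvPolynomial (Fin N) k ≃ₐ[k] MvPolynomial (Fin N) k} {γ : Fin N → ℚ} {t : List ℚ}
    (hexps : exps γ = (2 : ℚ) :: 2 :: 2 :: t)
    (ht : ATW.TruncLex.lt [((m + 1 : ℕ) : ℚ), ((m + 1 : ℕ) : ℚ)] t) :
    ¬ IsCentreFor (umbrellaQuad k i j l e₁ e₂ m) Ψ γ := by
  classical
  intro hc
  have hM0 : (0 : ℚ) < ((m + 1 : ℕ) : ℚ) := by positivity
  have hsorted : ((2 : ℚ) :: 2 :: 2 :: t).Pairwise (· ≤ ·) := hexps ▸ exps_sorted γ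
  have hts : t.Pairwise (· ≤ ·) :=
    (List.pairwise_cons.1 (List.pairwise_cons.1 (List.pairwise_cons.1 hsorted).2).2).2
  -- peel `a₁, a₂, a₃`
  obtain ⟨a₁, -, hγa₁, ht₁⟩ := exists_update_of_exps_eq_cons hexps
  obtain ⟨a₂, hγa₂0, hγa₂, ht₂⟩ := exists_update_of_exps_eq_cons ht₁
  have h₂₁ : a₂ ≠ a₁ := by rintro rfl; rw [Function.update_self] at hγa₂0; exact hγa₂0 rfl
  rw [Function.update_of_ne h₂₁] at hγa₂
  obtain ⟨a₃, hγa₃0, hγa₃, ht₃⟩ := exists_update_of_exps_eq_cons ht₂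
  have h₃₂ : a₃ ≠ a₂ := by rintro rfl; rw [Function.update_self] at hγa₃0; exact hγa₃0 rfl
  have h₃₁ : a₃ ≠ a₁ := by
    rintro rfl; rw [Function.update_of_ne h₃₂, Function.update_self] at hγa₃0; exact hγa₃0 rfl
  rw [Function.update_of_ne h₃₂, Function.update_of_ne h₃₁] at hγa₃
  set γ₃ := Function.update (Function.update (Function.update γ a₁ 0) a₂ 0) a₃ 0 with hγ₃
  have hγ₃eq : ∀ x, x ≠ a₁ → x ≠ a₂ → x ≠ a₃ → γ₃ x = γ x := fun x h1 h2 h3 => by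
    rw [hγ₃, Function.update_of_ne h3, Function.update_of_ne h2, Function.update_of_ne h1]
  have hγ₃a₁ : γ₃ a₁ = 0 := by
    rw [hγ₃, Function.update_of_ne (Ne.symm h₃₁), Function.update_of_ne (Ne.symm h₂₁), Function.update_self]
  have hγ₃a₂ : γ₃ a₂ = 0 := by rw [hγ₃, Function.update_of_ne (Ne.symm h₃₂), Function.update_self]
  have hγ₃a₃ : γ₃ a₃ = 0 := by rw [hγ₃, Function.update_self]
  have hγ₃nn : ∀ x, 0 ≤ γ₃ x := update_nonneg₈ (update_nonneg₈ (update_nonneg₈ hc.2.1 a₁) a₂) a₃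
  have hγa₁' : γ a₁ = 1 / 2 := by rw [hγa₁, one_div]
  have hγa₂' : γ a₂ = 1 / 2 := by rw [hγa₂, one_div]
  have hγa₃' : γ a₃ = 1 / 2 := by rw [hγa₃, one_div]
  -- it suffices to produce the weight data of the core lemma
  suffices key : ∃ d, d ≠ a₁ ∧ d ≠ a₂ ∧ d ≠ a₃ ∧ γ d ≤ 1 / ((m + 1 : ℕ) : ℚ) ∧
      ∃ c, ((m + 1 : ℕ) : ℚ) < c ∧ ∀ x, x ≠ a₁ → x ≠ a₂ → x ≠ a₃ → x ≠ d → γ x ≤ 1 / c by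
    obtain ⟨d, hd₁, hd₂, hd₃, hγd, c, hMc, hE⟩ := key
    obtain ⟨p, q, hpq, hcq⟩ := exists_ratio_of_lt₈ hMc
    exact not_isCentreFor_umbrellaQuad_vertex' hij hil hi₁ hi₂ hjl hj₁ hj₂ hl₁ hl₂ h₁₂ hm hγa₁' hγa₂'
      hγa₃' hd₁ hd₂ hd₃ hγd hpq (fun x h1 h2 h3 hxd => hcq ▸ hE x h1 h2 h3 hxd) hc
  have hzero : ∀ {δ : Fin N → ℚ}, exps δ = [] → ∀ x, δ x = 0 := by
    intro δ hδ x
    by_contra hx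
    have := inv_mem_exps_of_ne_zero₈ hx
    rw [hδ] at this
    simp at this
  rcases t with _ | ⟨c₄, t'⟩
  · -- `t = ()`: all other weights vanish
    obtain ⟨d, hd₁, hd₂, hd₃⟩ := exists_ne_ne_ne₄ hij hil hi₁ hjl hj₁ hl₁ a₁ a₂ a₃
    have hz : ∀ x, x ≠ a₁ → x ≠ a₂ → x ≠ a₃ → γ x = 0 := fun x h1 h2 h3 => by
      rw [← hγ₃eq x h1 h2 h3]; exact hzero ht₃ x
    refine ⟨d, hd₁, hd₂, hd₃, by rw [hz d hd₁ hd₂ hd₃]; positivity, ((m + 1 : ℕ) : ℚ) + 1, lt_add_one _,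
      fun x h1 h2 h3 _ => by rw [hz x h1 h2 h3]; positivity⟩
  · rw [ATW.TruncLex.cons_lt_cons] at ht
    rcases ht with hlt | ⟨heq, ht'⟩
    · -- `c₄ > m + 1`
      obtain ⟨d, hd₁, hd₂, hd₃⟩ := exists_ne_ne_ne₄ hij hil hi₁ hjl hj₁ hl₁ a₁ a₂ a₃
      have hbound : ∀ x, x ≠ a₁ → x ≠ a₂ → x ≠ a₃ → γ x ≤ 1 / c₄ := fun x h1 h2 h3 => by
        rw [← hγ₃eq x h1 h2 h3]
        exact le_inv_of_exps_eq ht₃ (hM0.trans hlt) (fun y hy => le_of_mem_of_pairwise₈ hts hy) hγ₃nn x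
      exact ⟨d, hd₁, hd₂, hd₃, (hbound d hd₁ hd₂ hd₃).trans (one_div_le_one_div_of_le hM0 hlt.le), c₄, hlt,
        fun x h1 h2 h3 _ => hbound x h1 h2 h3⟩
    · -- `c₄ = m + 1`: peel `d`
      subst heq
      obtain ⟨d, hγd0, hγd, htd⟩ := exists_update_of_exps_eq_cons ht₃
      have hd₁ : d ≠ a₁ := by rintro rfl; exact hγd0 hγ₃a₁
      have hd₂ : d ≠ a₂ := by rintro rfl; exact hγd0 hγ₃a₂
      have hd₃ : d ≠ a₃ := by rintro rfl; exact hγd0 hγ₃a₃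
      have hγd' : γ d = 1 / ((m + 1 : ℕ) : ℚ) := by rw [← hγ₃eq d hd₁ hd₂ hd₃, hγd, one_div]
      have hγ₄eq : ∀ x, x ≠ a₁ → x ≠ a₂ → x ≠ a₃ → x ≠ d → Function.update γ₃ d 0 x = γ x :=
        fun x h1 h2 h3 hxd => by rw [Function.update_of_ne hxd, hγ₃eq x h1 h2 h3]
      have hγ₄nn : ∀ x, 0 ≤ Function.update γ₃ d 0 x := update_nonneg₈ hγ₃nn d
      rcases t' with _ | ⟨c₅, t''⟩
      · -- `t = (m+1)`
        refine ⟨d, hd₁, hd₂, hd₃, hγd'.le, ((m + 1 : ℕ) : ℚ) + 1, lt_add_one _, fun x h1 h2 h3 hxd => ?_⟩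
        rw [← hγ₄eq x h1 h2 h3 hxd, hzero htd x]
        positivity
      · rw [ATW.TruncLex.cons_lt_cons] at ht'
        rcases ht' with hlt5 | ⟨-, hnil⟩
        · -- `t = (m+1, c₅, …)` with `c₅ > m+1`
          have hts' : (c₅ :: t'').Pairwise (· ≤ ·) := (List.pairwise_cons.1 hts).2
          refine ⟨d, hd₁, hd₂, hd₃, hγd'.le, c₅, hlt5, fun x h1 h2 h3 hxd => ?_⟩
          rw [← hγ₄eq x h1 h2 h3 hxd]
          exact le_inv_of_exps_eq htd (hM0.trans hlt5) (fun y hy => le_of_mem_of_pairwise₈ hts' hy) hγ₄nn x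
        · exact (ATW.TruncLex.not_nil_lt _ hnil).elim

/-- **`max W(X_i² + X_j^m X_l + X_{e₁} X_{e₂}) = (2, 2, 2, m+1, m+1)`** in the cell's polynomial
weighted-centre model (`i, j, l, e₁, e₂` distinct, any number of spectator variables, `m ≥ 2`, ALL polynomial
coordinate changes, EVERY field — no parity hypothesis; supersedes `isMaxInv_umbrellaQuad`): the invariant `(2, 2, 2, m+1, m+1)` of the coordinate centre
`(X_i², X_{e₁}², X_{e₂}², X_j^{m+1}, X_l^{m+1})` is attained and nothing in `W` exceeds it in the
truncated-lexicographic order. (derived here) Instrument of the Resolution Observatory — NOT a resolution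
theorem. [cite: AbramovichTemkinWlodarczyk2024, Thm. 5.3.1 (2) (p. 1578) (inv_p = max over admissible
centres); CossartJannsenSaito2020, Thm. 8.16 (p. 121); CossartPiltant2008, proof of Prop. 4.2;
Temkin2025, §1.2.2 (1) (p. 4)] -/
theorem isMaxInv_umbrellaQuad' (hij : i ≠ j) (hil : i ≠ l) (hi₁ : i ≠ e₁) (hi₂ : i ≠ e₂) (hjl : j ≠ l)
    (hj₁ : j ≠ e₁) (hj₂ : j ≠ e₂) (hl₁ : l ≠ e₁) (hl₂ : l ≠ e₂) (h₁₂ : e₁ ≠ e₂) (hm : 2 ≤ m) :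
    IsMaxInv (admissibleInvariants (umbrellaQuad k i j l e₁ e₂ m))
      [(2 : ℚ), 2, 2, ((m + 1 : ℕ) : ℚ), ((m + 1 : ℕ) : ℚ)] := by
  refine ⟨umbrellaQuad_inv_mem hij hil hi₁ hi₂ hjl hj₁ hj₂ hl₁ hl₂ h₁₂ (by omega), fun b hb => ?_⟩
  have hff := not_lt_of_mem_admissibleInvariants_umbrellaQuad hil hi₁ hi₂ hjl h₁₂ hm hb
  obtain ⟨Ψ, γ, hc, rfl⟩ := hb
  rcases hγ : exps γ with _ | ⟨b₁, _ | ⟨b₂, _ | ⟨b₃, t⟩⟩⟩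
  · rw [hγ] at hff
    exact (hff (ATW.TruncLex.cons_lt_nil _ _)).elim
  · rw [hγ] at hff
    intro h
    rw [ATW.TruncLex.cons_lt_cons] at h hff
    exact hff (h.imp id fun h2 => ⟨h2.1, ATW.TruncLex.cons_lt_nil _ _⟩)
  · rw [hγ] at hff
    intro h
    rw [ATW.TruncLex.cons_lt_cons, ATW.TruncLex.cons_lt_cons] at h hff
    exact hff (h.imp id fun h2 => ⟨h2.1, h2.2.imp id fun h3 => ⟨h3.1, ATW.TruncLex.cons_lt_nil _ _⟩⟩)
  · rw [hγ] at hff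
    intro h
    rw [ATW.TruncLex.cons_lt_cons, ATW.TruncLex.cons_lt_cons, ATW.TruncLex.cons_lt_cons] at h hff
    rcases h with h1 | ⟨h1, h2 | ⟨h2, h3 | ⟨h3, h4⟩⟩⟩
    · exact hff (Or.inl h1)
    · exact hff (Or.inr ⟨h1, Or.inl h2⟩)
    · exact hff (Or.inr ⟨h1, Or.inr ⟨h2, Or.inl h3⟩⟩)
    · subst h1 h2 h3
      exact not_isCentreFor_umbrellaQuad_of_exps' hij hil hi₁ hi₂ hjl hj₁ hj₂ hl₁ hl₂ h₁₂ hm hγ h4 hc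

/-- The smallest case the landed parity hypothesis excluded: `v² + w³u + yz` over ANY field (including
characteristic `2`): `IsMaxInv W [2, 2, 2, 4, 4]`. (derived here)
[cite: AbramovichTemkinWlodarczyk2024, Thm. 5.3.1 (2) (p. 1578); CossartPiltant2008, proof of Prop. 4.2] -/
theorem isMaxInv_umbrellaQuad_three (hij : i ≠ j) (hil : i ≠ l) (hi₁ : i ≠ e₁) (hi₂ : i ≠ e₂) (hjl : j ≠ l)
    (hj₁ : j ≠ e₁) (hj₂ : j ≠ e₂) (hl₁ : l ≠ e₁) (hl₂ : l ≠ e₂) (h₁₂ : e₁ ≠ e₂) :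
    IsMaxInv (admissibleInvariants (umbrellaQuad k i j l e₁ e₂ 3)) [(2 : ℚ), 2, 2, 4, 4] := by
  have h := isMaxInv_umbrellaQuad' (k := k) hij hil hi₁ hi₂ hjl hj₁ hj₂ hl₁ hl₂ h₁₂ (le_of_lt (by norm_num) : 2 ≤ 3)
  norm_num at h
  exact h

end Assembly


/-! ## §4 The purely inseparable second vertex of the cube-umbrella `X_i² + X_j^m X_l + X_e³` -/

section CubeSecondVertex

variable {i j l e : Fin N} {m : ℕ}

/-- An automorphism fixing the origin preserves constant coefficients (plumbing). [folklore] -/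
private theorem constantCoeff_map_of_fix₉ (Φ : MvPolynomial (Fin N) k ≃ₐ[k] MvPolynomial (Fin N) k)
    (hΦ : ∀ m, constantCoeff (Φ (X m)) = 0) (P : MvPolynomial (Fin N) k) :
    constantCoeff (Φ P) = constantCoeff P := by
  induction P using MvPolynomial.induction_on with
  | C a => rw [show Φ (C a) = C a from Φ.commutes a]
  | add p q hp hq => rw [map_add, map_add, hp, hq, map_add]
  | mul_X p m hp => rw [map_mul, map_mul, hp, hΦ, map_mul, constantCoeff_X]

/-- The constant coefficient of a partial derivative is the linear coefficient (plumbing). [folklore] -/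
private theorem constantCoeff_pderiv₉ (y : Fin N) (P : MvPolynomial (Fin N) k) :
    constantCoeff (pderiv y P) = coeff (Finsupp.single y 1) P := by
  classical
  induction P using MvPolynomial.induction_on with
  | C a =>
    rw [pderiv_C, map_zero, coeff_C, if_neg (Finsupp.single_ne_zero.2 one_ne_zero).symm]
  | add p q hp hq => rw [map_add, map_add, hp, hq, coeff_add]
  | mul_X p m hp =>
    rw [Derivation.leibniz, smul_eq_mul, smul_eq_mul, map_add, map_mul, map_mul, constantCoeff_X, zero_mul,
      add_zero, pderiv_X, coeff_mul_X']
    by_cases hmy : m = y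
    · subst hmy
      rw [Pi.single_eq_same, map_one, mul_one, if_pos (by simp), tsub_self, ← constantCoeff_eq]
    · have hns : m ∉ (Finsupp.single y 1).support := fun h =>
        hmy ((Finsupp.mem_support_single _ _ _).1 h).1
      rw [Pi.single_eq_of_ne hmy, map_zero, mul_zero, if_neg hns]

/-- `(p ∂_i + q ∂_x)(P) = p ∂_i P + q ∂_x P` (plumbing). [folklore] -/
private theorem sum_pairField_mul₉ {i x : Fin N} (hix : i ≠ x) (p q : MvPolynomial (Fin N) k)
    (D : Fin N → MvPolynomial (Fin N) k) :
    ∑ m, pairField i x p q m * D m = p * D i + q * D x := by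
  classical
  have : ∀ m, pairField i x p q m * D m = (if m = i then p * D i else 0) + (if m = x then q * D x else 0) := by
    intro m
    unfold pairField
    by_cases h1 : m = i
    · subst h1; rw [if_pos rfl, if_pos rfl, if_neg hix, add_zero]
    · rw [if_neg h1, if_neg h1, zero_add]
      by_cases h2 : m = x
      · subst h2; rw [if_pos rfl, if_pos rfl]
      · rw [if_neg h2, if_neg h2, zero_mul]
  rw [Finset.sum_congr rfl fun m _ => this m, Finset.sum_add_distrib, Finset.sum_ite_eq' Finset.univ i,
    Finset.sum_ite_eq' Finset.univ x, if_pos (Finset.mem_univ _), if_pos (Finset.mem_univ _)]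

/-- Slice `2` of a `SliceOrd` bound (plumbing). [folklore] -/
private theorem SliceOrd.coeff_two_le₉ {σ : Type*} {w : σ → ℕ} {α s : ℕ} {P : Polynomial (MvPolynomial σ k)}
    (h : SliceOrd w α s P) : ((s - 2 * α : ℕ) : ℕ∞) ≤ monomialOrd w (P.coeff 2) := h 2

/-- Coefficients of the normal form `C p₀ + C p₁ ε + C p₂ ε² + C p₃ ε³` (plumbing). [folklore] -/
private theorem coeff_normalForm₉ {R : Type*} [CommSemiring R] (p₀ p₁ p₂ p₃ : R) :
    (Polynomial.C p₀ + Polynomial.C p₁ * Polynomial.X + Polynomial.C p₂ * Polynomial.X ^ 2 +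
        Polynomial.C p₃ * Polynomial.X ^ 3).coeff 0 = p₀ ∧
    (Polynomial.C p₀ + Polynomial.C p₁ * Polynomial.X + Polynomial.C p₂ * Polynomial.X ^ 2 +
        Polynomial.C p₃ * Polynomial.X ^ 3).coeff 1 = p₁ ∧
    (Polynomial.C p₀ + Polynomial.C p₁ * Polynomial.X + Polynomial.C p₂ * Polynomial.X ^ 2 +
        Polynomial.C p₃ * Polynomial.X ^ 3).coeff 2 = p₂ := by
  simp only [Polynomial.coeff_add, Polynomial.coeff_C, Polynomial.coeff_C_mul_X, Polynomial.coeff_C_mul_X_pow]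
  simp

/-- **Second vertex of the cube-umbrella, weight form — the purely inseparable cases** (`2 = 0` and `m`
odd, or `3 = 0` and `3 ∣ m+1`).  For `f = X_i² + X_j^m X_l + X_e³` (`i, j, l, e` distinct, spectators
allowed, `m ≥ 3`) there is NO centre `(Ψ, γ)` —
`Ψ` ANY polynomial automorphism fixing the origin — with weights `γ a = 1/2`, `γ b = 1/3`, `γ d ≤ 1/(m+1)`
for some third variable `d`, and all other weights `≤ q/p` where `(m+1)q < p`.  Endgame: the graded
identity `(lin W)^m · lin U = κ X_d^{m+1} − in_{m+1}(V²) − in_{m+1}(Z³)` has vanishing partial derivatives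
(Frobenius on the inseparable term, the other term being a multiple of `X_d^{m+1}` with `m + 1 = 0` in `k`),
whence `lin U ∥ lin W` and the sheared rank obstruction applies. (derived here)
[cite: AbramovichTemkinWlodarczyk2024, Thm. 5.3.1 (2) (p. 1578), Lemma 5.2.6–5.2.10 (p. 1577), §3.4 (p. 1570);
CossartJannsenSaito2020, Def. 7.1 (p. 107), §2.2 (p. 21); CossartPiltant2008, proof of Prop. 4.2;
Temkin2025, §1.2.2 (1) (p. 4)] -/
theorem not_isCentreFor_umbrellaCube_vertex_insep (hij : i ≠ j) (hil : i ≠ l) (hie : i ≠ e) (hjl : j ≠ l)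
    (hje : j ≠ e) (hle : l ≠ e) (hm : 3 ≤ m) (hbad : ((2 : k) = 0 ∧ Odd m) ∨ ((3 : k) = 0 ∧ 3 ∣ m + 1))
    {Ψ : MvPolynomial (Fin N) k ≃ₐ[k] MvPolynomial (Fin N) k} {γ : Fin N → ℚ} {a b d : Fin N}
    (hγa : γ a = 1 / 2) (hγb : γ b = 1 / 3) (hda : d ≠ a) (hdb : d ≠ b)
    (hγd : γ d ≤ 1 / ((m + 1 : ℕ) : ℚ)) {p q : ℕ} (hq : 0 < q) (hpq : (m + 1) * q < p)
    (hE : ∀ x, x ≠ a → x ≠ b → x ≠ d → γ x ≤ (q : ℚ) / p) :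
    ¬ IsCentreFor (umbrellaCube k i j l e m) Ψ γ := by
  classical
  intro hc
  set f := umbrellaCube k i j l e m with hf
  obtain ⟨K, hK⟩ : ∃ K, (m + 1) * p = K := ⟨_, rfl⟩
  have hp0 : 0 < p := by omega
  have hK6 : 6 * (m + 1) * p = 6 * K := by rw [← hK]; ring
  -- numerics on the weights
  have hM0 : (0 : ℚ) < ((m + 1 : ℕ) : ℚ) := by positivity
  have hM4 : (4 : ℚ) ≤ ((m + 1 : ℕ) : ℚ) := by exact_mod_cast (by omega : 4 ≤ m + 1)
  have hqp : (q : ℚ) / p < 1 / ((m + 1 : ℕ) : ℚ) := by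
    rw [div_lt_div_iff₀ (by exact_mod_cast hp0) hM0, one_mul]
    calc (q : ℚ) * ((m + 1 : ℕ) : ℚ) = (((m + 1) * q : ℕ) : ℚ) := by push_cast; ring
      _ < p := by exact_mod_cast hpq
  have hM14 : 1 / ((m + 1 : ℕ) : ℚ) ≤ 1 / 4 := one_div_le_one_div_of_le (by norm_num) hM4
  have hab : a ≠ b := by rintro rfl; rw [hγa] at hγb; norm_num at hγb
  have hother : ∀ x, x ≠ a → γ x ≤ 1 / 3 := by
    intro x hxa
    by_cases hxb : x = b
    · rw [hxb, hγb]
    by_cases hxd : x = d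
    · rw [hxd]; linarith
    · linarith [hE x hxa hxb hxd]
  have hle2 : ∀ x, γ x ≤ 1 / 2 := by
    intro x
    by_cases hxa : x = a
    · rw [hxa, hγa]
    · linarith [hother x hxa]
  have huniq : ∀ x, γ x = 1 / 2 → x = a := by
    intro x hx
    by_contra hxa
    linarith [hother x hxa]
  -- the apex variable: `lin Ψ(X_a) = λ X_i`, `λ ≠ 0`
  obtain ⟨hD, hLi⟩ := coeff_single_apex_of_initial (monomialOrd_umbrellaCube hil hie hjl (by omega))
    (homogeneousComponent_umbrellaCube (by omega)) (hironakaDelta_umbrellaCube hij hil hie hle (by omega))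
    hc hγa hle2 huniq
  -- the restriction `ρ = κ ∘ Ψ⁻¹`, `κ` killing `X_a, X_b`
  set H : Finset (Fin N) := {a, b} with hH
  obtain ⟨ρ, hρ⟩ : ∃ ρ : MvPolynomial (Fin N) k →ₐ[k] MvPolynomial (Fin N) k,
      ∀ P, ρ P = killHom H (Ψ.symm P) :=
    ⟨(killHom H).comp (Ψ.symm : MvPolynomial (Fin N) k →ₐ[k] MvPolynomial (Fin N) k), fun _ => rfl⟩
  have hρΨ : ∀ x, ρ (Ψ (X x)) = killHom H (X x) := fun x => by rw [hρ, AlgEquiv.symm_apply_apply]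
  have hρa : ρ (Ψ (X a)) = 0 := by rw [hρΨ, killHom_X_of_mem (by simp [hH])]
  have hρb : ρ (Ψ (X b)) = 0 := by rw [hρΨ, killHom_X_of_mem (by simp [hH])]
  have hρx : ∀ x, x ≠ a → x ≠ b → ρ (Ψ (X x)) = X x := fun x hxa hxb => by
    rw [hρΨ, killHom_X_of_not_mem (by simp [hH, hxa, hxb])]
  have hΨs0 : ∀ x, constantCoeff (Ψ.symm (X x)) = 0 := constantCoeff_symm_X_eq_zero_of_forall Ψ hc.1
  have hρ0 : ∀ P, constantCoeff (ρ P) = constantCoeff P := fun P => by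
    rw [hρ, constantCoeff_killHom, constantCoeff_map_of_fix₉ Ψ.symm hΨs0]
  have hρ1 : ∀ P y, y ≠ a → y ≠ b → coeff (Finsupp.single y 1) (ρ P) = coeff (Finsupp.single y 1) (Ψ.symm P) := by
    intro P y hya hyb
    rw [hρ, coeff_killHom_of_forall_eq_zero]
    intro x hx
    simp only [hH, Finset.mem_insert, Finset.mem_singleton] at hx
    rcases hx with rfl | rfl
    · exact Finsupp.single_eq_of_ne (Ne.symm hya)
    · exact Finsupp.single_eq_of_ne (Ne.symm hyb)
  set v' := Ψ (X a) with hv'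
  set V := ρ (X i) with hV
  set W := ρ (X j) with hW
  set U := ρ (X l) with hU
  set Z := ρ (X e) with hZ
  set L := ρ (pderiv i v') with hL
  set A := ρ (pderiv e v') with hA
  have hV0 : constantCoeff V = 0 := by rw [hV, hρ0, constantCoeff_X]
  have hW0 : constantCoeff W = 0 := by rw [hW, hρ0, constantCoeff_X]
  have hU0 : constantCoeff U = 0 := by rw [hU, hρ0, constantCoeff_X]
  have hZ0 : constantCoeff Z = 0 := by rw [hZ, hρ0, constantCoeff_X]
  have hL0 : constantCoeff L ≠ 0 := by rw [hL, hρ0, constantCoeff_pderiv₉]; exact hLi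
  have hρv' : ρ v' = 0 := hρa
  -- integer weights: `6p` on `X_d`, `6(m+1)q` elsewhere; source weights `qs`
  obtain ⟨Wt, hWt⟩ : ∃ Wt : Fin N → ℕ, Wt = heavyWeights d (m + 1) p q := ⟨_, rfl⟩
  have hWtle : ∀ x, Wt x ≤ 2 * K := by
    intro x
    rw [hWt, heavyWeights]
    split_ifs
    · nlinarith
    · nlinarith
  obtain ⟨qs, hqs⟩ : ∃ qs : Fin N → ℕ, ∀ x, qs x = if x = a then 3 * K else if x = b then 2 * K else Wt x :=
    ⟨_, fun _ => rfl⟩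
  have hqsa : qs a = 3 * K := by rw [hqs, if_pos rfl]
  have hqsb : qs b = 2 * K := by rw [hqs, if_neg (Ne.symm hab), if_pos rfl]
  have hqsx : ∀ x, x ≠ a → x ≠ b → qs x = Wt x := fun x hxa hxb => by rw [hqs, if_neg hxa, if_neg hxb]
  -- admissibility of `Ψ⁻¹ f` in the source weights
  have hqsγ : ∀ x, (6 * K : ℚ) * γ x ≤ (qs x : ℚ) := by
    intro x
    by_cases hxa : x = a
    · rw [hxa, hqsa, hγa]; push_cast; linarith
    by_cases hxb : x = b
    · rw [hxb, hqsb, hγb]; push_cast; linarith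
    rw [hqsx x hxa hxb, hWt, heavyWeights]
    have hKq : (K : ℚ) = ((m + 1 : ℕ) : ℚ) * p := by rw [← hK]; push_cast; ring
    by_cases hxd : x = d
    · rw [if_pos hxd, hxd]
      calc (6 * K : ℚ) * γ d ≤ 6 * K * (1 / ((m + 1 : ℕ) : ℚ)) := mul_le_mul_of_nonneg_left hγd (by positivity)
        _ = ((6 * p : ℕ) : ℚ) := by rw [hKq]; field_simp; push_cast; ring
    · rw [if_neg hxd]
      calc (6 * K : ℚ) * γ x ≤ 6 * K * ((q : ℚ) / p) := mul_le_mul_of_nonneg_left (hE x hxa hxb hxd) (by positivity)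
        _ = ((6 * (m + 1) * q : ℕ) : ℚ) := by
          rw [hKq]; field_simp; push_cast; ring
  have hadm : ∀ dd ∈ (Ψ.symm f).support, 6 * K ≤ Finsupp.weight qs dd := by
    intro dd hdd
    have h1 : (1 : ℚ) ≤ ∑ x, (dd x : ℚ) * γ x := by
      rw [← monomialValuation_eq_sum_univ₈]; exact hc.2.2 dd hdd
    have h2 : ((Finsupp.weight qs dd : ℕ) : ℚ) = ∑ x, (dd x : ℚ) * (qs x : ℚ) := by
      rw [weight_eq_sum_univ₈]; push_cast; rfl
    have h3 : ((6 * K : ℕ) : ℚ) ≤ ∑ x, (dd x : ℚ) * (qs x : ℚ) := by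
      calc ((6 * K : ℕ) : ℚ) = (6 * K : ℚ) * 1 := by push_cast; ring
        _ ≤ (6 * K : ℚ) * ∑ x, (dd x : ℚ) * γ x := mul_le_mul_of_nonneg_left h1 (by positivity)
        _ = ∑ x, (dd x : ℚ) * ((6 * K : ℚ) * γ x) := by rw [Finset.mul_sum]; exact Finset.sum_congr rfl fun x _ => by ring
        _ ≤ ∑ x, (dd x : ℚ) * (qs x : ℚ) :=
          Finset.sum_le_sum fun x _ => mul_le_mul_of_nonneg_left (hqsγ x) (by positivity)
    rw [← h2] at h3
    exact_mod_cast h3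
  -- SliceOrd bounds for the generators, and the transfer to `f`
  have hgen : ∀ (ξ : Fin N → MvPolynomial (Fin N) k) (α : ℕ), 2 * K ≤ α →
      SliceOrd Wt α (3 * K) (fieldTaylorₐ ρ ξ v') → ∀ x, SliceOrd Wt α (qs x) (fieldTaylorₐ ρ ξ (Ψ (X x))) := by
    intro ξ α hα ha x
    by_cases hxa : x = a
    · rw [hxa, hqsa]; exact ha
    have hq2 : qs x ≤ 2 * K := by
      by_cases hxb : x = b
      · rw [hxb, hqsb]
      · rw [hqsx x hxa hxb]; exact hWtle x
    refine sliceOrd_of_coeff ?_ ?_ (by omega)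
    · rw [coeff_zero_fieldTaylorₐ]
      by_cases hxb : x = b
      · rw [hxb, hρb, monomialOrd_zero]; exact le_top
      · rw [hρx x hxa hxb, monomialOrd_X, hqsx x hxa hxb]
    · rw [Nat.sub_eq_zero_of_le (hq2.trans hα), Nat.cast_zero]; exact zero_le
  have hTf : ∀ (ξ : Fin N → MvPolynomial (Fin N) k) (α : ℕ), 2 * K ≤ α →
      SliceOrd Wt α (3 * K) (fieldTaylorₐ ρ ξ v') → SliceOrd Wt α (6 * K) (fieldTaylorₐ ρ ξ f) := by
    intro ξ α hα ha
    have h := SliceOrd.map (φ := (fieldTaylorₐ ρ ξ).comp (Ψ : MvPolynomial (Fin N) k →ₐ[k] MvPolynomial (Fin N) k))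
      qs (fun x => hgen ξ α hα ha x) (F := Ψ.symm f) hadm
    have h' : SliceOrd Wt α (6 * K) (fieldTaylorₐ ρ ξ (Ψ (Ψ.symm f))) := h
    rwa [AlgEquiv.apply_symm_apply] at h'
  -- (T1) the direction `∂_i`
  set ξ₁ : Fin N → MvPolynomial (Fin N) k := fun x => if x = i then 1 else 0 with hξ₁
  have hT1 : SliceOrd Wt (3 * K) (6 * K) (fieldTaylorₐ ρ ξ₁ f) := by
    refine hTf ξ₁ (3 * K) (by omega) (sliceOrd_of_coeff ?_ ?_ (by omega))
    · rw [coeff_zero_fieldTaylorₐ, hρv', monomialOrd_zero]; exact le_top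
    · rw [Nat.sub_self, Nat.cast_zero]; exact zero_le
  have hexp1 : fieldTaylorₐ ρ ξ₁ f = Polynomial.C (V ^ 2 + W ^ m * U + Z ^ 3) + Polynomial.C (2 * V) * Polynomial.X +
      Polynomial.C 1 * Polynomial.X ^ 2 + Polynomial.C 0 * Polynomial.X ^ 3 := by
    have e1 : ξ₁ i = 1 := by simp [hξ₁]
    have e2 : ξ₁ j = 0 := by simp [hξ₁, hij.symm]
    have e3 : ξ₁ l = 0 := by simp [hξ₁, hil.symm]
    have e4 : ξ₁ e = 0 := by simp [hξ₁, hie.symm]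
    rw [hf, umbrellaCube_eq]
    simp only [map_add, map_mul, map_pow, fieldTaylorₐ_X, e1, e2, e3, e4, map_one, map_zero, mul_zero, add_zero]
    simp only [map_ofNat]
    ring
  have hG : ((6 * K : ℕ) : ℕ∞) ≤ monomialOrd Wt (V ^ 2 + W ^ m * U + Z ^ 3) := by
    have h := hT1.coeff_zero_le₈; rwa [hexp1, (coeff_normalForm₉ _ _ _ _).1] at h
  have hEv : ((3 * K : ℕ) : ℕ∞) ≤ monomialOrd Wt (2 * V) := by
    have h := hT1.coeff_one_le₈
    rwa [hexp1, (coeff_normalForm₉ _ _ _ _).2.1, show 6 * K - 3 * K = 3 * K by omega] at h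
  -- (T2) the direction `ξ = (∂_i v') ∂_e − (∂_e v') ∂_i`, tangent to `v' = 0`
  set ξ₂ := pairField i e (-pderiv e v') (pderiv i v') with hξ₂
  have hT2 : SliceOrd Wt (2 * K) (6 * K) (fieldTaylorₐ ρ ξ₂ f) := by
    refine hTf ξ₂ (2 * K) le_rfl (sliceOrd_of_coeff ?_ ?_ (by omega))
    · rw [coeff_zero_fieldTaylorₐ, hρv', monomialOrd_zero]; exact le_top
    · have hsum : ∑ x, ξ₂ x * pderiv x v' = 0 := by rw [hξ₂, sum_pairField_mul₉ hie]; ring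
      rw [coeff_one_fieldTaylorₐ, hsum, map_zero, monomialOrd_zero]; exact le_top
  have hexp2 : fieldTaylorₐ ρ ξ₂ f = Polynomial.C (V ^ 2 + W ^ m * U + Z ^ 3) +
      Polynomial.C (3 * L * Z ^ 2 - A * (2 * V)) * Polynomial.X + Polynomial.C (A ^ 2 + 3 * L ^ 2 * Z) * Polynomial.X ^ 2 +
      Polynomial.C (L ^ 3) * Polynomial.X ^ 3 := by
    have e1 : ξ₂ i = -pderiv e v' := by simp [hξ₂, pairField]
    have e2 : ξ₂ e = pderiv i v' := by simp [hξ₂, pairField, hie.symm]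
    have e3 : ξ₂ j = 0 := by simp [hξ₂, pairField, hij.symm, hje]
    have e4 : ξ₂ l = 0 := by simp [hξ₂, pairField, hil.symm, hle]
    rw [hf, umbrellaCube_eq]
    simp only [map_add, map_mul, map_pow, fieldTaylorₐ_X, e1, e2, e3, e4, map_neg, map_zero, mul_zero, add_zero]
    simp only [map_sub, map_mul, map_pow, map_ofNat]
    ring
  have hE1 : ((4 * K : ℕ) : ℕ∞) ≤ monomialOrd Wt (3 * L * Z ^ 2 - A * (2 * V)) := by
    have h := hT2.coeff_one_le₈
    rwa [hexp2, (coeff_normalForm₉ _ _ _ _).2.1, show 6 * K - 2 * K = 4 * K by omega] at h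
  have hE2 : ((2 * K : ℕ) : ℕ∞) ≤ monomialOrd Wt (A ^ 2 + 3 * L ^ 2 * Z) := by
    have h := hT2.coeff_two_le₉
    rwa [hexp2, (coeff_normalForm₉ _ _ _ _).2.2, show 6 * K - 2 * (2 * K) = 2 * K by omega] at h
  -- (B) in characteristic `≠ 3`: `ord Z ≥ 2K`
  have hZ2 : (3 : k) ≠ 0 → ((2 * K : ℕ) : ℕ∞) ≤ monomialOrd Wt Z := by
    intro h3
    by_contra hlt
    push Not at hlt
    obtain ⟨t, ht'⟩ := ENat.ne_top_iff_exists.1 hlt.ne_top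
    have ht : monomialOrd Wt Z = t := ht'.symm
    have htK : t < 2 * K := by rw [ht] at hlt; exact_mod_cast hlt
    have hu3L : constantCoeff (3 * L) ≠ 0 := by
      rw [map_mul, map_ofNat]; exact mul_ne_zero h3 hL0
    have h1 : monomialOrd Wt (3 * L * Z ^ 2) = ((2 * t : ℕ) : ℕ∞) := by
      rw [monomialOrd_mul_of_constantCoeff_ne_zero Wt hu3L, pow_two, monomialOrd_mul, ht, ← Nat.cast_add]
      congr 1; omega
    by_cases hs : monomialOrd Wt (A * (2 * V)) = monomialOrd Wt (3 * L * Z ^ 2)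
    · rw [monomialOrd_mul, h1] at hs
      have hAtop : monomialOrd Wt A ≠ ⊤ := by
        intro htop; rw [htop, top_add] at hs; exact ENat.top_ne_coe _ hs
      have hVtop : monomialOrd Wt (2 * V) ≠ ⊤ := by
        intro htop; rw [htop, add_top] at hs; exact ENat.top_ne_coe _ hs
      obtain ⟨α', hα''⟩ := ENat.ne_top_iff_exists.1 hAtop
      obtain ⟨β', hβ''⟩ := ENat.ne_top_iff_exists.1 hVtop
      have hα' : monomialOrd Wt A = α' := hα''.symm
      have hβ' : monomialOrd Wt (2 * V) = β' := hβ''.symm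
      rw [hα', hβ', ← Nat.cast_add] at hs
      have hsum : α' + β' = 2 * t := by exact_mod_cast hs
      have hβ3 : 3 * K ≤ β' := by rw [hβ'] at hEv; exact_mod_cast hEv
      have h2 : monomialOrd Wt (A ^ 2) = ((2 * α' : ℕ) : ℕ∞) := by
        rw [pow_two, monomialOrd_mul, hα', ← Nat.cast_add]; congr 1; omega
      have hu3L2 : constantCoeff (3 * L ^ 2) ≠ 0 := by
        rw [map_mul, map_pow, map_ofNat]; exact mul_ne_zero h3 (pow_ne_zero 2 hL0)
      have h3' : monomialOrd Wt (3 * L ^ 2 * Z) = t := by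
        rw [monomialOrd_mul_of_constantCoeff_ne_zero Wt hu3L2, ht]
      have hlt2 : monomialOrd Wt (A ^ 2) < monomialOrd Wt (3 * L ^ 2 * Z) := by
        rw [h2, h3']; exact_mod_cast (by omega : 2 * α' < t)
      have hE2' := hE2
      rw [add_comm, monomialOrd_add_eq_of_lt hlt2, h2] at hE2'
      have : 2 * K ≤ 2 * α' := by exact_mod_cast hE2'
      omega
    · have hE1' := hE1
      rcases lt_or_gt_of_ne hs with hlt' | hgt'
      · rw [monomialOrd_sub_eq_of_lt hlt'] at hE1'
        have h' := hE1'.trans hlt'.le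
        rw [h1] at h'
        have : 4 * K ≤ 2 * t := by exact_mod_cast h'
        omega
      · rw [sub_eq_neg_add, monomialOrd_add_eq_of_lt (by rwa [monomialOrd_neg']), h1] at hE1'
        have : 4 * K ≤ 2 * t := by exact_mod_cast hE1'
        omega
  -- low-degree components: `in_M` of the three summands of `G = V² + W^m U + Z³` (`M = m + 1`)
  have hpq' : (m + 1) * q < p := hpq
  have hVsq : (2 : k) ≠ 0 → ∃ κ : k, homogeneousComponent (m + 1) (V ^ 2) = C κ * X d ^ (m + 1) := by
    intro h2
    have hu2 : constantCoeff (2 : MvPolynomial (Fin N) k) ≠ 0 := by rwa [map_ofNat]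
    have hV3 : ((3 * K : ℕ) : ℕ∞) ≤ monomialOrd Wt V := by
      rwa [monomialOrd_mul_of_constantCoeff_ne_zero Wt hu2] at hEv
    have hV6 : ((6 * (m + 1) * p : ℕ) : ℕ∞) ≤ monomialOrd (heavyWeights d (m + 1) p q) (V ^ 2) := by
      rw [hK6, ← hWt, pow_two, show 6 * K = 3 * K + 3 * K by omega, Nat.cast_add]
      exact (add_le_add hV3 hV3).trans (add_monomialOrd_le_mul Wt V V)
    exact ⟨_, (homogeneousComponent_of_le_monomialOrd_heavyWeights hpq' hV6).2⟩
  have hZcube : (3 : k) ≠ 0 → ∃ κ : k, homogeneousComponent (m + 1) (Z ^ 3) = C κ * X d ^ (m + 1) := by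
    intro h3
    have hZ2' := hZ2 h3
    have hZ6 : ((6 * (m + 1) * p : ℕ) : ℕ∞) ≤ monomialOrd (heavyWeights d (m + 1) p q) (Z ^ 3) := by
      rw [hK6, ← hWt, pow_succ, pow_two, show 6 * K = 2 * K + 2 * K + 2 * K by omega, Nat.cast_add, Nat.cast_add]
      exact (add_le_add ((add_le_add hZ2' hZ2').trans (add_monomialOrd_le_mul Wt Z Z)) hZ2').trans
        (add_monomialOrd_le_mul Wt _ Z)
    exact ⟨_, (homogeneousComponent_of_le_monomialOrd_heavyWeights hpq' hZ6).2⟩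
  have hG' : ((6 * (m + 1) * p : ℕ) : ℕ∞) ≤ monomialOrd (heavyWeights d (m + 1) p q) (V ^ 2 + W ^ m * U + Z ^ 3) := by
    rw [hK6, ← hWt]; exact hG
  obtain ⟨hGlow, hGM⟩ := homogeneousComponent_of_le_monomialOrd_heavyWeights hpq' hG'
  -- degree-order bounds
  have hV1 : ((1 : ℕ) : ℕ∞) ≤ monomialOrd (fun _ => 1) V := by
    rw [Nat.cast_one]; exact one_le_monomialOrd_one_of_constantCoeff_eq_zero _ hV0
  have hW1 : ((1 : ℕ) : ℕ∞) ≤ monomialOrd (fun _ => 1) W := by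
    rw [Nat.cast_one]; exact one_le_monomialOrd_one_of_constantCoeff_eq_zero _ hW0
  have hU1 : ((1 : ℕ) : ℕ∞) ≤ monomialOrd (fun _ => 1) U := by
    rw [Nat.cast_one]; exact one_le_monomialOrd_one_of_constantCoeff_eq_zero _ hU0
  have hZ1 : ((1 : ℕ) : ℕ∞) ≤ monomialOrd (fun _ => 1) Z := by
    rw [Nat.cast_one]; exact one_le_monomialOrd_one_of_constantCoeff_eq_zero _ hZ0
  have hWm : ((m : ℕ) : ℕ∞) ≤ monomialOrd (fun _ => 1) (W ^ m) := by
    have h := nsmul_monomialOrd_le_pow (fun _ => 1) W m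
    refine le_trans ?_ h
    calc ((m : ℕ) : ℕ∞) = m • ((1 : ℕ) : ℕ∞) := by rw [Nat.cast_one, nsmul_one]
      _ ≤ m • monomialOrd (fun _ => 1) W := nsmul_le_nsmul_right hW1 m
  have hWU : ((m + 1 : ℕ) : ℕ∞) ≤ monomialOrd (fun _ => 1) (W ^ m * U) := by
    rw [Nat.cast_add]
    exact (add_le_add hWm hU1).trans (add_monomialOrd_le_mul _ _ _)
  have hZ3 : ((3 : ℕ) : ℕ∞) ≤ monomialOrd (fun _ => 1) (Z ^ 3) := by
    have h := nsmul_monomialOrd_le_pow (fun _ => 1) Z 3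
    refine le_trans ?_ h
    calc ((3 : ℕ) : ℕ∞) = 3 • ((1 : ℕ) : ℕ∞) := by rw [Nat.cast_one, nsmul_one]
      _ ≤ 3 • monomialOrd (fun _ => 1) Z := nsmul_le_nsmul_right hZ1 3
  -- `lin V = 0`
  have hlinV : homogeneousComponent 1 V = 0 := by
    have h2G := hGlow 2 (by omega)
    have hsq := homogeneousComponent_mul_pow_of_le_monomialOrd V hV1 2
    rw [Nat.mul_one] at hsq
    rw [map_add, map_add, hsq, homogeneousComponent_eq_zero_of_lt_monomialOrd _ (by omega : 2 < m + 1) hWU,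
      homogeneousComponent_eq_zero_of_lt_monomialOrd _ (by norm_num : 2 < 3) hZ3, add_zero, add_zero] at h2G
    exact pow_eq_zero_iff two_ne_zero |>.1 h2G
  have hV2 : ((2 : ℕ) : ℕ∞) ≤ monomialOrd (fun _ => 1) V := by
    refine le_monomialOrd_one_of_homogeneousComponent_eq_zero V fun n hn => ?_
    interval_cases n
    · rw [homogeneousComponent_zero, ← constantCoeff_eq, hV0, C_0]
    · exact hlinV
  -- `lin Z = 0`
  have hlinZ : homogeneousComponent 1 Z = 0 := by
    have h3G := hGlow 3 (by omega)
    have hcb := homogeneousComponent_mul_pow_of_le_monomialOrd Z hZ1 3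
    rw [Nat.mul_one] at hcb
    have hV4 : ((4 : ℕ) : ℕ∞) ≤ monomialOrd (fun _ => 1) (V ^ 2) := by
      rw [pow_two, show (4 : ℕ) = 2 + 2 from rfl, Nat.cast_add]
      exact (add_le_add hV2 hV2).trans (add_monomialOrd_le_mul _ V V)
    rw [map_add, map_add, hcb, homogeneousComponent_eq_zero_of_lt_monomialOrd _ (by omega : 3 < m + 1) hWU,
      homogeneousComponent_eq_zero_of_lt_monomialOrd _ (by norm_num : 3 < 4) hV4, zero_add, zero_add] at h3G
    exact pow_eq_zero_iff three_ne_zero |>.1 h3G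
  -- `(lin W)^m · lin U = κ X_d^{m+1}`
  have hprod : homogeneousComponent (m + 1) (W ^ m * U) = homogeneousComponent 1 W ^ m * homogeneousComponent 1 U := by
    have hpw := homogeneousComponent_mul_pow_of_le_monomialOrd W hW1 m
    rw [Nat.mul_one] at hpw
    rw [homogeneousComponent_add_mul_of_le_monomialOrd (W ^ m) U hWm hU1, hpw]
  set κG := coeff (Finsupp.single d (m + 1)) (V ^ 2 + W ^ m * U + Z ^ 3) with hκG
  have hstar : linForm (fun y => coeff (Finsupp.single y 1) W) ^ m * linForm (fun y => coeff (Finsupp.single y 1) U) =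
      C κG * X d ^ (m + 1) - homogeneousComponent (m + 1) (V ^ 2) - homogeneousComponent (m + 1) (Z ^ 3) := by
    rw [← homogeneousComponent_one_eq_linForm, ← homogeneousComponent_one_eq_linForm, ← hprod]
    rw [map_add, map_add] at hGM
    rw [← hGM]; ring
  -- the right-hand side has vanishing partial derivatives
  have hM : (((m + 1 : ℕ) : ℕ) : k) = 0 := by
    rcases hbad with ⟨h2, ⟨r, hr⟩⟩ | ⟨h3, ⟨r, hr⟩⟩
    · rw [hr, show 2 * r + 1 + 1 = 2 * (r + 1) by ring, Nat.cast_mul, Nat.cast_ofNat, h2, zero_mul]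
    · rw [show ((m + 1 : ℕ) : ℕ) = 3 * r from hr, Nat.cast_mul, Nat.cast_ofNat, h3, zero_mul]
  have hmk : (m : k) ≠ 0 := by
    have h1 : (m : k) + 1 = 0 := by rw [← Nat.cast_succ]; exact hM
    rw [show (m : k) = -1 from eq_neg_of_add_eq_zero_left h1]
    exact neg_ne_zero.2 one_ne_zero
  have hR : ∀ y, pderiv y (C κG * X d ^ (m + 1) - homogeneousComponent (m + 1) (V ^ 2) -
      homogeneousComponent (m + 1) (Z ^ 3)) = 0 := by
    intro y
    rw [map_sub, map_sub, pderiv_C_mul_X_pow_eq_zero y d hM, zero_sub]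
    rcases hbad with ⟨h2, -⟩ | ⟨h3, -⟩
    · have h3 : (3 : k) ≠ 0 := by
        rw [show (3 : k) = 2 + 1 by norm_num, h2, zero_add]; exact one_ne_zero
      obtain ⟨κZ, hκZ⟩ := hZcube h3
      rw [hκZ, pderiv_C_mul_X_pow_eq_zero y d hM, pderiv_homogeneousComponent_sq_eq_zero h2 y (by omega),
        neg_zero, sub_zero]
    · have h2 : (2 : k) ≠ 0 := by
        intro h2
        exact one_ne_zero (show (1 : k) = 0 by linear_combination h3 - h2)
      obtain ⟨κV, hκV⟩ := hVsq h2
      rw [hκV, pderiv_C_mul_X_pow_eq_zero y d hM, pderiv_homogeneousComponent_cube_eq_zero h3 y (by omega),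
        neg_zero, sub_zero]
  -- rows of the Jacobian of `Ψ⁻¹` at `0`
  have hrow : ∀ x s, s ≠ a → s ≠ b → coeff (Finsupp.single s 1) (ρ (X x)) = 0 →
      coeff (Finsupp.single s 1) (Ψ.symm (X x)) = 0 := by
    intro x s hsa hsb h
    rwa [hρ1 (X x) s hsa hsb] at h
  have hrowV := coeff_single_one_eq_zero_of_lin' hlinV
  have hrowZ := coeff_single_one_eq_zero_of_lin' hlinZ
  have hcardF3 : ∀ x y z : Fin N, x ≠ y → x ≠ z → y ≠ z → ({x, y, z} : Finset (Fin N)).card = 3 := by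
    intro x y z hxy hxz hyz
    rw [Finset.card_insert_of_notMem (by simp [hxy, hxz]), Finset.card_pair hyz]
  rcases linForm_prop_of_pderiv_eq_zero (by omega : 1 ≤ m) hmk hR hstar with hWz | ⟨μ, hμ⟩
  · -- `lin W = 0`: rows `i, j, e` supported on the columns `a, b`
    refine false_of_jacobian_rows_supported hc.1 {i, j, e} {a, b}
      (lt_of_le_of_lt Finset.card_le_two (by rw [hcardF3 i j e hij hie hje]; norm_num)) ?_
    intro s hs x hx
    simp only [Finset.mem_insert, Finset.mem_singleton, not_or] at hs hx
    obtain ⟨hsa, hsb⟩ := hs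
    refine hrow x s hsa hsb ?_
    rcases hx with rfl | rfl | rfl
    · exact hrowV s
    · exact hWz s
    · exact hrowZ s
  · -- `lin U = μ · lin W`: rows `i, e` vanish and row `l − μ · row j` vanishes off the columns `a, b`
    refine false_of_jacobian_rows_supported_shear hc.1 {i, e} {a, b}
      (lt_of_le_of_lt Finset.card_le_two (by rw [Finset.card_pair hie]; norm_num)) hjl.symm
      (by simp [hil.symm, hle]) μ ?_ ?_
    · intro s hs x hx
      simp only [Finset.mem_insert, Finset.mem_singleton, not_or] at hs hx
      obtain ⟨hsa, hsb⟩ := hs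
      refine hrow x s hsa hsb ?_
      rcases hx with rfl | rfl
      · exact hrowV s
      · exact hrowZ s
    · intro s hs
      simp only [Finset.mem_insert, Finset.mem_singleton, not_or] at hs
      obtain ⟨hsa, hsb⟩ := hs
      rw [← hρ1 (X l) s hsa hsb, ← hρ1 (X j) s hsa hsb]
      exact hμ s

/-- **Second vertex of the cube-umbrella, weight form, EVERY characteristic** (`m ≥ 3`; no parity
hypotheses): the landed `not_isCentreFor_umbrellaCube_vertex` glued with the purely inseparable cases
above. (derived here)
[cite: AbramovichTemkinWlodarczyk2024, Thm. 5.3.1 (2) (p. 1578); CossartPiltant2008, proof of Prop. 4.2;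
Temkin2025, §1.2.2 (1) (p. 4)] -/
theorem not_isCentreFor_umbrellaCube_vertex' (hij : i ≠ j) (hil : i ≠ l) (hie : i ≠ e) (hjl : j ≠ l)
    (hje : j ≠ e) (hle : l ≠ e) (hm : 3 ≤ m)
    {Ψ : MvPolynomial (Fin N) k ≃ₐ[k] MvPolynomial (Fin N) k} {γ : Fin N → ℚ} {a b d : Fin N}
    (hγa : γ a = 1 / 2) (hγb : γ b = 1 / 3) (hda : d ≠ a) (hdb : d ≠ b)
    (hγd : γ d ≤ 1 / ((m + 1 : ℕ) : ℚ)) {p q : ℕ} (hq : 0 < q) (hpq : (m + 1) * q < p)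
    (hE : ∀ x, x ≠ a → x ≠ b → x ≠ d → γ x ≤ (q : ℚ) / p) :
    ¬ IsCentreFor (umbrellaCube k i j l e m) Ψ γ := by
  by_cases h : ((2 : k) ≠ 0 ∨ Even m) ∧ ((3 : k) ≠ 0 ∨ ¬ 3 ∣ m + 1)
  · exact not_isCentreFor_umbrellaCube_vertex hij hil hie hjl hje hle hm h.1 h.2 hγa hγb hda hdb hγd hq hpq hE
  · have hbad : ((2 : k) = 0 ∧ Odd m) ∨ ((3 : k) = 0 ∧ 3 ∣ m + 1) := by
      rcases not_and_or.1 h with h | h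
      · rw [not_or, not_not, Nat.not_even_iff_odd] at h; exact Or.inl h
      · rw [not_or, not_not, not_not] at h; exact Or.inr h
    exact not_isCentreFor_umbrellaCube_vertex_insep hij hil hie hjl hje hle hm hbad hγa hγb hda hdb hγd hq hpq hE

end CubeSecondVertex

/-! ## §5 `max W(X_i² + X_j^m X_l + X_e³) = (2, 3, m+1, m+1)` in every characteristic -/

section CubeAssembly

variable {i j l e : Fin N} {m : ℕ}

/-- Three distinct indices leave one outside any pair (plumbing). [folklore] -/
private theorem exists_ne_ne₉ {i j l : Fin N} (hij : i ≠ j) (hil : i ≠ l) (hjl : j ≠ l) (a b : Fin N) :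
    ∃ d, d ≠ a ∧ d ≠ b := by
  by_cases hia : i = a
  · by_cases hjb : j = b
    · exact ⟨l, fun h => hil (hia.trans h.symm), fun h => hjl (hjb.trans h.symm)⟩
    · exact ⟨j, fun h => hij (hia.trans h.symm), hjb⟩
  · by_cases hib : i = b
    · by_cases hja : j = a
      · exact ⟨l, fun h => hjl (hja.trans h.symm), fun h => hil (hib.trans h.symm)⟩
      · exact ⟨j, hja, fun h => hij (hib.trans h.symm)⟩
    · exact ⟨i, hia, hib⟩

/-- A rational `c > M` as a ratio `p/q` of naturals with `Mq < p` (plumbing). [folklore] -/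
private theorem exists_ratio_of_lt₉ {M : ℕ} {c : ℚ} (hMc : (M : ℚ) < c) :
    ∃ p q : ℕ, 0 < q ∧ M * q < p ∧ 1 / c = (q : ℚ) / p := by
  have hc0 : 0 < c := lt_of_le_of_lt (Nat.cast_nonneg M) hMc
  have hnum : 0 < c.num := Rat.num_pos.2 hc0
  have hp : ((c.num.toNat : ℕ) : ℚ) = (c.num : ℚ) := by exact_mod_cast Int.toNat_of_nonneg hnum.le
  have key : c * c.den = c.num := Rat.mul_den_eq_num c
  refine ⟨c.num.toNat, c.den, c.den_pos, ?_, ?_⟩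
  · have h : (M : ℚ) * c.den < c * c.den := mul_lt_mul_of_pos_right hMc (by exact_mod_cast c.den_pos)
    rw [key, ← hp] at h
    exact_mod_cast h
  · rw [hp, div_eq_div_iff hc0.ne' (by exact_mod_cast hnum.ne'), one_mul, mul_comm]
    exact key.symm

/-- **Second vertex, invariant form**: no centre for `X_i² + X_j^m X_l + X_e³` has invariant
`(2, 3, t…)` with `(m+1, m+1) <_trunc t` — i.e. `t = ()`, or `t = (c₃, …)` with `c₃ > m+1`, or
`t = (m+1)`, or `t = (m+1, c₄, …)` with `c₄ > m+1` (`m ≥ 3`; EVERY characteristic; ALL polynomial coordinate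
changes). (derived here)
[cite: AbramovichTemkinWlodarczyk2024, Thm. 5.3.1 (2) (p. 1578); CossartPiltant2008, proof of Prop. 4.2;
Temkin2025, §1.2.2 (1) (p. 4)] -/
theorem not_isCentreFor_umbrellaCube_of_exps' (hij : i ≠ j) (hil : i ≠ l) (hie : i ≠ e) (hjl : j ≠ l)
    (hje : j ≠ e) (hle : l ≠ e) (hm : 3 ≤ m)
    {Ψ : MvPolynomial (Fin N) k ≃ₐ[k] MvPolynomial (Fin N) k} {γ : Fin N → ℚ} {t : List ℚ}
    (hexps : exps γ = (2 : ℚ) :: 3 :: t)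
    (ht : ATW.TruncLex.lt [((m + 1 : ℕ) : ℚ), ((m + 1 : ℕ) : ℚ)] t) :
    ¬ IsCentreFor (umbrellaCube k i j l e m) Ψ γ := by
  classical
  intro hc
  have hM0 : (0 : ℚ) < ((m + 1 : ℕ) : ℚ) := by positivity
  have hsorted : ((2 : ℚ) :: 3 :: t).Pairwise (· ≤ ·) := hexps ▸ exps_sorted γ
  have hts : t.Pairwise (· ≤ ·) := (List.pairwise_cons.1 (List.pairwise_cons.1 hsorted).2).2
  -- peel `a` and `b`
  obtain ⟨a, -, hγa, hta⟩ := exists_update_of_exps_eq_cons hexps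
  obtain ⟨b, hγb0, hγb, htb⟩ := exists_update_of_exps_eq_cons hta
  have hba : b ≠ a := by rintro rfl; rw [Function.update_self] at hγb0; exact hγb0 rfl
  rw [Function.update_of_ne hba] at hγb
  set γ₂ := Function.update (Function.update γ a 0) b 0 with hγ₂
  have hγ₂eq : ∀ x, x ≠ a → x ≠ b → γ₂ x = γ x := fun x hxa hxb => by
    rw [hγ₂, Function.update_of_ne hxb, Function.update_of_ne hxa]
  have hγ₂a : γ₂ a = 0 := by rw [hγ₂, Function.update_of_ne (Ne.symm hba), Function.update_self]
  have hγ₂b : γ₂ b = 0 := by rw [hγ₂, Function.update_self]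
  have hγ₂nn : ∀ x, 0 ≤ γ₂ x := update_nonneg₈ (update_nonneg₈ hc.2.1 a) b
  have hγa' : γ a = 1 / 2 := by rw [hγa, one_div]
  have hγb' : γ b = 1 / 3 := by rw [hγb, one_div]
  -- it suffices to produce the weight data of the core lemma
  suffices key : ∃ d, d ≠ a ∧ d ≠ b ∧ γ d ≤ 1 / ((m + 1 : ℕ) : ℚ) ∧
      ∃ c, ((m + 1 : ℕ) : ℚ) < c ∧ ∀ x, x ≠ a → x ≠ b → x ≠ d → γ x ≤ 1 / c by
    obtain ⟨d, hda, hdb, hγd, c, hMc, hE⟩ := key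
    obtain ⟨p, q, hq, hpq, hcq⟩ := exists_ratio_of_lt₉ hMc
    exact not_isCentreFor_umbrellaCube_vertex' hij hil hie hjl hje hle hm hγa' hγb' hda hdb hγd hq
      hpq (fun x hxa hxb hxd => hcq ▸ hE x hxa hxb hxd) hc
  have hzero : ∀ {δ : Fin N → ℚ}, exps δ = [] → ∀ x, δ x = 0 := by
    intro δ hδ x
    by_contra hx
    have := inv_mem_exps_of_ne_zero₈ hx
    rw [hδ] at this
    simp at this
  rcases t with _ | ⟨c₃, t'⟩
  · -- `t = ()`: all other weights vanish
    obtain ⟨d, hda, hdb⟩ := exists_ne_ne₉ hij hil hjl a b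
    have hz : ∀ x, x ≠ a → x ≠ b → γ x = 0 := fun x hxa hxb => by rw [← hγ₂eq x hxa hxb]; exact hzero htb x
    refine ⟨d, hda, hdb, by rw [hz d hda hdb]; positivity, ((m + 1 : ℕ) : ℚ) + 1, lt_add_one _,
      fun x hxa hxb _ => by rw [hz x hxa hxb]; positivity⟩
  · rw [ATW.TruncLex.cons_lt_cons] at ht
    rcases ht with hlt | ⟨heq, ht'⟩
    · -- `c₃ > m + 1`
      obtain ⟨d, hda, hdb⟩ := exists_ne_ne₉ hij hil hjl a b
      have hbound : ∀ x, x ≠ a → x ≠ b → γ x ≤ 1 / c₃ := fun x hxa hxb => by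
        rw [← hγ₂eq x hxa hxb]
        exact le_inv_of_exps_eq htb (hM0.trans hlt) (fun y hy => le_of_mem_of_pairwise₈ hts hy) hγ₂nn x
      exact ⟨d, hda, hdb, (hbound d hda hdb).trans (one_div_le_one_div_of_le hM0 hlt.le), c₃, hlt,
        fun x hxa hxb _ => hbound x hxa hxb⟩
    · -- `c₃ = m + 1`: peel `d`
      subst heq
      obtain ⟨d, hγd0, hγd, htd⟩ := exists_update_of_exps_eq_cons htb
      have hda : d ≠ a := by rintro rfl; exact hγd0 hγ₂a
      have hdb : d ≠ b := by rintro rfl; exact hγd0 hγ₂b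
      have hγd' : γ d = 1 / ((m + 1 : ℕ) : ℚ) := by rw [← hγ₂eq d hda hdb, hγd, one_div]
      have hγ₃eq : ∀ x, x ≠ a → x ≠ b → x ≠ d → Function.update γ₂ d 0 x = γ x := fun x hxa hxb hxd => by
        rw [Function.update_of_ne hxd, hγ₂eq x hxa hxb]
      have hγ₃nn : ∀ x, 0 ≤ Function.update γ₂ d 0 x := update_nonneg₈ hγ₂nn d
      rcases t' with _ | ⟨c₄, t''⟩
      · -- `t = (m+1)`
        refine ⟨d, hda, hdb, hγd'.le, ((m + 1 : ℕ) : ℚ) + 1, lt_add_one _, fun x hxa hxb hxd => ?_⟩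
        rw [← hγ₃eq x hxa hxb hxd, hzero htd x]
        positivity
      · rw [ATW.TruncLex.cons_lt_cons] at ht'
        rcases ht' with hlt4 | ⟨-, hnil⟩
        · -- `t = (m+1, c₄, …)` with `c₄ > m+1`
          have hts' : (c₄ :: t'').Pairwise (· ≤ ·) := (List.pairwise_cons.1 hts).2
          refine ⟨d, hda, hdb, hγd'.le, c₄, hlt4, fun x hxa hxb hxd => ?_⟩
          rw [← hγ₃eq x hxa hxb hxd]
          exact le_inv_of_exps_eq htd (hM0.trans hlt4) (fun y hy => le_of_mem_of_pairwise₈ hts' hy) hγ₃nn x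
        · exact (ATW.TruncLex.not_nil_lt _ hnil).elim

/-- **`max W(X_i² + X_j^m X_l + X_e³) = (2, 3, m+1, m+1)`** in the cell's polynomial weighted-centre model
(`i, j, l, e` distinct, any number of spectator variables, `m ≥ 3`, ALL polynomial coordinate changes,
EVERY field — no parity hypotheses; supersedes `isMaxInv_umbrellaCube`): the invariant `(2, 3, m+1, m+1)` of the
coordinate centre `(X_i², X_e³, X_j^{m+1}, X_l^{m+1})` is attained and nothing in `W` exceeds it in the
truncated-lexicographic order. (derived here) Instrument of the Resolution Observatory — NOT a resolution
theorem. [cite: AbramovichTemkinWlodarczyk2024, Thm. 5.3.1 (2) (p. 1578) (inv_p = max over admissible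
centres); CossartJannsenSaito2020, Thm. 8.16 (p. 121); CossartPiltant2008, proof of Prop. 4.2;
Temkin2025, §1.2.2 (1) (p. 4)] -/
theorem isMaxInv_umbrellaCube' (hij : i ≠ j) (hil : i ≠ l) (hie : i ≠ e) (hjl : j ≠ l) (hje : j ≠ e)
    (hle : l ≠ e) (hm : 3 ≤ m) :
    IsMaxInv (admissibleInvariants (umbrellaCube k i j l e m))
      [(2 : ℚ), 3, ((m + 1 : ℕ) : ℚ), ((m + 1 : ℕ) : ℚ)] := by
  refine ⟨umbrellaCube_inv_mem hij hil hie hjl hje hle (by omega), fun b hb => ?_⟩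
  have hff := not_lt_of_mem_admissibleInvariants_umbrellaCube hij hil hie hjl hle (by omega) hb
  obtain ⟨Ψ, γ, hc, rfl⟩ := hb
  rcases hγ : exps γ with _ | ⟨b₁, _ | ⟨b₂, t⟩⟩
  · rw [hγ] at hff
    exact (hff (ATW.TruncLex.cons_lt_nil _ _)).elim
  · rw [hγ] at hff
    intro h
    rw [ATW.TruncLex.cons_lt_cons] at h hff
    exact hff (h.imp id fun h2 => ⟨h2.1, ATW.TruncLex.cons_lt_nil _ _⟩)
  · rw [hγ] at hff
    intro h
    rw [ATW.TruncLex.cons_lt_cons, ATW.TruncLex.cons_lt_cons] at h hff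
    rcases h with h1 | ⟨h1, h2 | ⟨h2, h3⟩⟩
    · exact hff (Or.inl h1)
    · exact hff (Or.inr ⟨h1, Or.inl h2⟩)
    · subst h1 h2
      exact not_isCentreFor_umbrellaCube_of_exps' hij hil hie hjl hje hle hm hγ h3 hc

/-- The smallest cases the landed parity hypotheses excluded: `v² + w⁵u + z³` over ANY field (including
characteristics `2` and `3`): `IsMaxInv W [2, 3, 6, 6]`. (derived here)
[cite: AbramovichTemkinWlodarczyk2024, Thm. 5.3.1 (2) (p. 1578); CossartPiltant2008, proof of Prop. 4.2] -/
theorem isMaxInv_umbrellaCube_five (hij : i ≠ j) (hil : i ≠ l) (hie : i ≠ e) (hjl : j ≠ l) (hje : j ≠ e)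
    (hle : l ≠ e) : IsMaxInv (admissibleInvariants (umbrellaCube k i j l e 5)) [(2 : ℚ), 3, 6, 6] := by
  have h := isMaxInv_umbrellaCube' (k := k) hij hil hie hjl hje hle (by norm_num : 3 ≤ 5)
  norm_num at h
  exact h

end CubeAssembly

end Literature.AlgebraicGeometry.Resolution.WeightedBlowup
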